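import Literature.Analysis.Fourier.PaleyWienerDeformationAffine
import Literature.Barriers.AtomisticToContinuum.NoBVEstimatesMultiDFinitePropagationConstant
import Literature.Barriers.AtomisticToContinuum.NoBVEstimatesMultiDLinearStepZerothOrder
import HarnessLib

/-!
# Finite speed of propagation for constant-coefficient systems in Rauch's class WITH zeroth-order
term, and the discharge of `Rauch1986_linearL1EstimateForcesCommutation`

`NoBVEstimatesMultiDFinitePropagationConstant.lean` proves finite speed of propagation for the
constant-coefficient systems `A₀∂ₜu + Σ Aⱼ∂ⱼu = 0` in Rauch's class at `0`
(`hasPropagationSpeed_ofConstant`, no zeroth-order term) and thereby discharges Rauch's reduction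
`Rauch1986_L1GradientEstimate_imp_LpMultiplier`. Rauch's linear step WITH zeroth-order term,
the named fact `Rauch1986_linearL1EstimateForcesCommutation` of `NoBVEstimatesMultiDProofs.lean`
(for `A₀∂ₜv + Σ Aⱼ∂ⱼv + B₁v = 0` in Rauch's class at `0`: Rauch's `L¹` gradient estimate (5) at one
time `T` forces `[A₀⁻¹Aⱼ, A₀⁻¹A_l] = 0`), is reduced in
`NoBVEstimatesMultiDLinearStepZerothOrder.lean`
(`Rauch1986_linearL1EstimateForcesCommutation_of_interpolation`, whose interpolation input is the
theorem `gradientLpBound_interpolation_holds`) to finite speed of propagation for the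
constant-coefficient system `ofConstant A₀ A B₁` WITH its zeroth-order term — used, exactly as in
[Rauch1986, Proof of Theorem p. 483], to know that the solutions `v` of hypothesis (5) stay
compactly supported on `[0, T]`, so that `v(T) = M_T(D)φ`. This file proves that case
(`hasPropagationSpeed_ofConstant_zeroth`) and discharges the fact
(`Rauch1986_linearL1EstimateForcesCommutation_holds`).

## The proof (Holmgren–John duality, as in the companion file, with the zeroth-order term)

1. *Adjoint generator.* The adjoint system is `A₀ᵀ∂ₜw + Σ Aⱼᵀ∂ⱼw - B₁ᵀw = 0`; on the Fourier side
   `∂ₜŵ = H*(ξ)ŵ` with the AFFINE generator `H*(ξ) = E* - G*(ξ)`, `E* = (A₀⁻¹)ᵀ_ℂ B₁ᵀ_ℂ`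
   (`adjZeroth`, `adjGenB`), so the symbol of the adjoint evolution is
   `exp((t - t₀)E* + L_{t-t₀}ξ)` (`adjSymB`), the exponential of an affine pencil. Its complex
   deformations along the segment `θ(t - t₀)E*`, `0 ≤ θ ≤ 1`, are transposed conjugates of Rauch's
   multiplier with the zeroth-order term `B_b - θB₁`, `B_b = -2πb Σν_lA_l`
   (`symMA_adjPencil_zeroth_eq`), so Brenner's bound (0.3) in the form of
   `NoBVEstimatesMultiDSymbolBound.lean` (the principal part drops out of the energy identity, the
   zeroth-order term enters through `e^{|τ|N'/m}`, `N' ≲ |b| + ‖B₁‖`) gives the affine exponential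
   type `|exp(θτE* + L_τξ + ibL_τν)ᵢⱼ| ≤ C e^{c₁|τ|} e^{2πc₀|τ||b|}`
     (`exists_hasExpTypeA_adjPencilB`).
2. *Adjoint solutions* `w(t) = M*_{t₀,t}(D)ψ`
  (`adjSolB`): support in `B̄(x₁, r + c₀|t - t₀|)` by the
   affine Paley–Wiener deformation theorem
   (`Literature.Analysis.Fourier.multiplierOp_expAffine_apply_eq_zero_of_dist`,
   `PaleyWienerDeformationAffine.lean`); `w(t₀) = ψ`; `∂ⱼw = M*(D)∂ⱼψ`; `∂ₜw = 𝓕⁻¹[H*M*𝓕ψ]`; and the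
   adjoint equation (`adjoint_eqnB`). All bounds now grow like `e^{c₁|t-t₀|}`.
3. *Duality.* For a classical solution `u` of `A₀∂ₜu + Σ Aⱼ∂ⱼu + B₁u = 0` on `[0, T]`,
   `P(t) = ∫ (A₀u(t, x))_ℂ · w(t, x) dx` has `P' = 0` on `(0, t₀)`: in
   `P' = ∫ [(A₀∂ₜu)·w + (A₀u)·∂ₜw]` the two equations produce `-Σⱼ ∫ ∂ⱼ[(Aⱼu)·w]` (which integrates
   to `0`) and the zeroth-order terms `-(B₁u)·w + u·(B₁ᵀw) = 0` cancel pointwise (`pairFB'_eq`).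
   Hence `∫ (A₀u(t₀))_ℂ·ψ = P(t₀) = P(0) = 0` when the supports at time `0` are disjoint, and
   localising with bumps gives `u(t₀, x₁) = 0` (`hasPropagationSpeed_ofConstant_zeroth`).

Finally `Rauch1986_linearL1EstimateForcesCommutation_holds` repeats the eight-line assembly of
`Rauch1986_linearL1EstimateForcesCommutation_of_interpolation` with the fact
`Rauch1986_finitePropagationSpeed` — there applied only to `ofConstant A₀ A B₁` — replaced by
`hasPropagationSpeed_ofConstant_zeroth`, and `NoBVEstimatesMultiDBarrier_of_expansion_propagation`
records Rauch's theorem relative to the two remaining inputs (the `L²` small-amplitude expansion and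
finite propagation speed for general quasilinear systems in Rauch's class).

## References

* [Rauch1986] J. Rauch, Comm. Math. Phys. 106 (1986) 481–484: Theorem p. 482 (linear case),
  Proof of Theorem pp. 482–483, (4)–(6) and the last sentence.
* [Brenner1973] P. Brenner, Ark. Mat. 11 (1973) 75–101, (0.3) p. 75.
* [HormanderALPDO2] L. Hörmander, *The Analysis of Linear Partial Differential Operators II*,
  Thm 12.5.1 (shift of contour with lower-order terms) and Thm 12.5.6 (domain of dependence).
-/

noncomputable section

open MeasureTheory Set Filter Matrix FourierTransform Metric Complex
open scoped ENNReal NNReal ContDiff Topology RealInnerProductSpace Matrix.Norms.Operator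

namespace Literature.Barriers.AtomisticToContinuum

open Literature.Analysis.Fourier Literature.Analysis.FluidPDE QuasilinearSystem

variable {d k : ℕ}

/-! ### Small tools -/

/-- `𝓕(f - g)(ξ) = 𝓕f(ξ) - 𝓕g(ξ)` for integrable `f, g`. [folklore] -/
theorem fourier_sub_apply {f g : Space d → Fin k → ℂ} (hf : Integrable f) (hg : Integrable g)
    (ξ : Space d) : 𝓕 (fun x => f x - g x) ξ = 𝓕 f ξ - 𝓕 g ξ := by
  have h := fourier_add_apply hf hg.neg ξ
  have h1 : (fun x => f x + (-g) x) = fun x => f x - g x := by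
    funext x; simp [sub_eq_add_neg]
  have h2 : 𝓕 (-g) ξ = -𝓕 g ξ := by
    rw [Real.fourier_eq, Real.fourier_eq, ← integral_neg]
    refine integral_congr_ae (Eventually.of_forall fun v => ?_)
    show (𝐞 (-⟪v, ξ⟫) : Circle) • (-g) v = -((𝐞 (-⟪v, ξ⟫) : Circle) • g v)
    rw [Pi.neg_apply, Circle.smul_def, Circle.smul_def, smul_neg]
  rw [h1, h2] at h
  rw [h, sub_eq_add_neg]

/-- Complexification of a real scalar multiple of a real matrix. [folklore] -/
theorem matrix_map_real_smul (θ : ℝ) (M : Matrix (Fin k) (Fin k) ℝ) :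
    (θ • M).map (algebraMap ℝ ℂ) = ((θ : ℝ) : ℂ) • M.map (algebraMap ℝ ℂ) := by
  ext i j
  simp

/-- Entry sums are subadditive. [folklore] -/
theorem sum_abs_add_le (M N : Matrix (Fin k) (Fin k) ℝ) :
    ∑ i, ∑ j, |(M + N) i j| ≤ (∑ i, ∑ j, |M i j|) + ∑ i, ∑ j, |N i j| := by
  rw [← Finset.sum_add_distrib]
  refine Finset.sum_le_sum fun i _ => ?_
  rw [← Finset.sum_add_distrib]
  exact Finset.sum_le_sum fun j _ => abs_add_le _ _

/-! ### The adjoint zeroth-order term and the generator identities -/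

section AdjointZeroth

variable (A₀ : Matrix (Fin k) (Fin k) ℝ) (A : Fin d → Matrix (Fin k) (Fin k) ℝ)
  (B₁ : (Fin k → ℝ) →L[ℝ] (Fin k → ℝ))

/-- The matrix of the zeroth-order term. [folklore] -/
abbrev zerothMatrix : Matrix (Fin k) (Fin k) ℝ :=
  LinearMap.toMatrix' (B₁ : (Fin k → ℝ) →ₗ[ℝ] (Fin k → ℝ))

/-- The zeroth-order term of the adjoint generator, `E* = (A₀⁻¹)ᵀ_ℂ B₁ᵀ_ℂ`: the adjoint system
`A₀ᵀ∂ₜw + Σ Aⱼᵀ∂ⱼw - B₁ᵀw = 0` reads `∂ₜŵ = (E* - G*(ξ))ŵ` on the Fourier side.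
[cite: Rauch1986, Proof of Theorem p. 483] -/
def adjZeroth : Matrix (Fin k) (Fin k) ℂ :=
  ((A₀⁻¹)ᵀ).map (algebraMap ℝ ℂ) * ((zerothMatrix B₁)ᵀ).map (algebraMap ℝ ℂ)

variable {A₀ A B₁}

/-- The matrix of `B - θ • B'`. [folklore] -/
theorem zerothMatrix_sub_smul (B B' : (Fin k → ℝ) →L[ℝ] (Fin k → ℝ)) (θ : ℝ) :
    zerothMatrix (B - θ • B') = zerothMatrix B - θ • zerothMatrix B' := by
  simp [zerothMatrix]

/-- **Rauch's generator is affine in the zeroth-order term**: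
`rauchGenerator A₀ A (B - θB') ξ = rauchGenerator A₀ A B ξ - θ (A₀⁻¹)_ℂ (B')_ℂ`. [folklore] -/
theorem rauchGenerator_sub_smul (B B' : (Fin k → ℝ) →L[ℝ] (Fin k → ℝ)) (θ : ℝ) (ξ : Space d) :
    rauchGenerator A₀ A (B - θ • B') ξ = rauchGenerator A₀ A B ξ -
      ((θ : ℝ) : ℂ) • ((A₀⁻¹).map (algebraMap ℝ ℂ) * (zerothMatrix B').map (algebraMap ℝ ℂ)) := by
  unfold rauchGenerator
  rw [show LinearMap.toMatrix' ((B - θ • B' : (Fin k → ℝ) →L[ℝ] (Fin k → ℝ)) :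
      (Fin k → ℝ) →ₗ[ℝ] (Fin k → ℝ)) = zerothMatrix (B - θ • B') from rfl, zerothMatrix_sub_smul,
    Matrix.map_sub _ (map_sub _), matrix_map_real_smul, ← add_sub_assoc, Matrix.mul_sub, Matrix.mul_smul]

/-- **The adjoint generator at the complex frequency `ξ + ibν`, moved along the segment of
zeroth-order terms, is the transposed conjugate of Rauch's generator with zeroth-order term
`B_b - θB₁`**: `G*(ξ) + ib G*(ν) - θE* = (A₀_ℂ · rauchGenerator A₀ A (B_b - θB₁) ξ · (A₀⁻¹)_ℂ)ᵀ`.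
[cite: Rauch1986, Proof of Theorem p. 483] -/
theorem adjGen_add_smul_sub_eq (hdet : A₀.det ≠ 0) (ν ξ : Space d) (b θ : ℝ) :
    adjGen A₀ A ξ + ((b : ℂ) * I) • adjGen A₀ A ν - ((θ : ℝ) : ℂ) • adjZeroth A₀ B₁ =
      (A₀.map (algebraMap ℝ ℂ) * rauchGenerator A₀ A (shiftCLM A ν b - θ • B₁) ξ *
        (A₀⁻¹).map (algebraMap ℝ ℂ))ᵀ := by
  rw [rauchGenerator_sub_smul, Matrix.mul_sub, Matrix.sub_mul, transpose_sub,
    ← adjGen_add_smul_eq (A := A) hdet ν ξ b]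
  congr 1
  rw [Matrix.mul_smul, Matrix.smul_mul, transpose_smul, ← Matrix.mul_assoc, map_mul_map_inv hdet,
    Matrix.one_mul, transpose_mul, ← transpose_map, ← transpose_map]
  rfl

/-- **The deformed affine adjoint symbols are transposed conjugates of Rauch's multiplier with the
zeroth-order term `B_b - θB₁`**:
`exp(θτE* + L_τ ξ + ib L_τ ν) = (A₀_ℂ · rauchSymbol A₀ A (B_b - θB₁) τ ξ · (A₀⁻¹)_ℂ)ᵀ`.
[cite: Rauch1986, Proof of Theorem p. 483] -/
theorem symMA_adjPencil_zeroth_eq (hdet : A₀.det ≠ 0) (τ θ : ℝ) (ν : Space d) (b : ℝ)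
    (ξ : Space d) :
    symMA (((θ : ℝ) : ℂ) • ((((τ : ℝ) : ℂ)) • adjZeroth A₀ B₁)) (adjPencil A₀ A τ) ν b ξ =
      (A₀.map (algebraMap ℝ ℂ) * rauchSymbol A₀ A (shiftCLM A ν b - θ • B₁) τ ξ *
        (A₀⁻¹).map (algebraMap ℝ ℂ))ᵀ := by
  have hU := isUnit_map hdet
  -- the exponent is `(-τ) • (G*(ξ) + ib G*(ν) - θE*)`
  have hexp : ((θ : ℝ) : ℂ) • ((((τ : ℝ) : ℂ)) • adjZeroth A₀ B₁) + adjPencil A₀ A τ ξ +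
      ((b : ℂ) * I) • adjPencil A₀ A τ ν =
      (-(τ : ℂ)) • (adjGen A₀ A ξ + ((b : ℂ) * I) • adjGen A₀ A ν -
        ((θ : ℝ) : ℂ) • adjZeroth A₀ B₁) := by
    rw [adjPencil_apply, adjPencil_apply]
    module
  rw [symMA, hexp]
  -- transport the generator identity into the goal
  have hX := congrArg (fun X : Matrix (Fin k) (Fin k) ℂ => NormedSpace.exp ((-(τ : ℂ)) • X))
    (adjGen_add_smul_sub_eq (A := A) (B₁ := B₁) hdet ν ξ b θ)
  refine (Eq.trans (by rfl) hX).trans ?_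
  rw [← transpose_smul, rauchSymbol,
    show (-(τ : ℂ)) • (A₀.map (algebraMap ℝ ℂ) * rauchGenerator A₀ A (shiftCLM A ν b - θ • B₁) ξ *
      (A₀⁻¹).map (algebraMap ℝ ℂ)) = A₀.map (algebraMap ℝ ℂ) *
      ((-(τ : ℂ)) • rauchGenerator A₀ A (shiftCLM A ν b - θ • B₁) ξ) *
        (A₀.map (algebraMap ℝ ℂ))⁻¹ by
    rw [Matrix.mul_smul, Matrix.smul_mul, map_inv_eq_inv_map hdet],
    Matrix.exp_transpose, Matrix.exp_conj _ _ hU, ← map_inv_eq_inv_map hdet]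

/-! ### Brenner's bound with the zeroth-order term `B_b - θB₁` -/

/-- **The pointwise bound with the zeroth-order term `B_b - θB₁`**: from a symmetrizer `R` at `ξ`
(`RA₀` symmetric with coercivity `m` and entry sum `≤ N`, `R Σξ_lA_l` symmetric, `Σ|Rᵢⱼ| ≤ K_R`),
`Σ|(B₁)ᵢⱼ| ≤ K_B` and `0 ≤ θ ≤ 1`, the entries of `rauchSymbol A₀ A (B_b - θB₁) τ ξ` are at most
`√(N/m) e^{(K_RK_B/m)|τ|} e^{(2πK_RK_A/m)|τ||b|}`, `K_A = Σ_l Σ|A_lᵢⱼ|`.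
[cite: Brenner1973, (0.3) p. 75] -/
theorem norm_rauchSymbol_shift_sub_apply_le (hdet : A₀.det ≠ 0) {R : Matrix (Fin k) (Fin k) ℝ}
    {ξ : Space d} (hsymm₀ : (R * A₀).IsSymm) (hsymm : (R * ∑ l, ξ l • A l).IsSymm)
    {m N KR KB : ℝ} (hm : 0 < m)
    (hcoer : ∀ y : Fin k → ℂ, m * ‖y‖ ^ 2 ≤ (star y ⬝ᵥ ((R * A₀).map (algebraMap ℝ ℂ) *ᵥ y)).re)
    (hN : ∑ i, ∑ j, |(R * A₀) i j| ≤ N) (hKR : ∑ i, ∑ j, |R i j| ≤ KR)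
    (hKB : ∑ i, ∑ j, |zerothMatrix B₁ i j| ≤ KB) {ν : Space d} (hν : ‖ν‖ ≤ 1) (τ b : ℝ) {θ : ℝ}
    (hθ : θ ∈ Icc (0 : ℝ) 1) (a b' : Fin k) :
    ‖rauchSymbol A₀ A (shiftCLM A ν b - θ • B₁) τ ξ a b'‖ ≤
      Real.sqrt (N / m) * Real.exp ((KR * KB / m) * |τ|) *
        Real.exp ((2 * Real.pi * (KR * (∑ l, ∑ i, ∑ j, |A l i j|) / m) * |τ|) * |b|) := by
  set KA : ℝ := ∑ l, ∑ i, ∑ j, |A l i j| with hKA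
  have hKR0 : 0 ≤ KR :=
    le_trans (Finset.sum_nonneg fun i _ => Finset.sum_nonneg fun j _ => abs_nonneg _) hKR
  have hKA0 : 0 ≤ KA := Finset.sum_nonneg fun l _ =>
    Finset.sum_nonneg fun i _ => Finset.sum_nonneg fun j _ => abs_nonneg _
  have hKB0 : 0 ≤ KB :=
    le_trans (Finset.sum_nonneg fun i _ => Finset.sum_nonneg fun j _ => abs_nonneg _) hKB
  have hnn : ∀ M : Matrix (Fin k) (Fin k) ℝ, 0 ≤ ∑ i, ∑ j, |M i j| := fun M =>
    Finset.sum_nonneg fun i _ => Finset.sum_nonneg fun j _ => abs_nonneg _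
  -- the entry sum of `R (B_b - θB₁)`
  have hN' : ∑ i, ∑ j, |(R * LinearMap.toMatrix'
      ((shiftCLM A ν b - θ • B₁ : (Fin k → ℝ) →L[ℝ] (Fin k → ℝ)) :
        (Fin k → ℝ) →ₗ[ℝ] (Fin k → ℝ))) i j| ≤ 2 * Real.pi * |b| * (KR * KA) + KR * KB := by
    rw [show LinearMap.toMatrix' ((shiftCLM A ν b - θ • B₁ : (Fin k → ℝ) →L[ℝ] (Fin k → ℝ)) :
        (Fin k → ℝ) →ₗ[ℝ] (Fin k → ℝ)) = zerothMatrix (shiftCLM A ν b - θ • B₁) from rfl,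
      zerothMatrix_sub_smul, show zerothMatrix (shiftCLM A ν b) = LinearMap.toMatrix'
        (shiftCLM A ν b : (Fin k → ℝ) →ₗ[ℝ] (Fin k → ℝ)) from rfl, toMatrix'_shiftCLM,
      Matrix.mul_sub, sub_eq_add_neg, Matrix.mul_smul, Matrix.mul_smul, ← neg_smul]
    refine (sum_abs_add_le _ _).trans (add_le_add ?_ ?_)
    · rw [sum_abs_smul, abs_neg, abs_mul, abs_of_pos Real.two_pi_pos]
      refine mul_le_mul_of_nonneg_left ?_ (by positivity)
      exact (sum_abs_mul_le R _).trans (mul_le_mul hKR (sum_abs_pencil_le A hν) (hnn _) hKR0)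
    · rw [sum_abs_smul, abs_neg, abs_of_nonneg hθ.1]
      calc θ * ∑ i, ∑ j, |(R * zerothMatrix B₁) i j| ≤ 1 * ∑ i, ∑ j, |(R * zerothMatrix B₁) i j| :=
            mul_le_mul_of_nonneg_right hθ.2 (hnn _)
        _ ≤ KR * KB := by
            rw [one_mul]
            exact (sum_abs_mul_le R _).trans (mul_le_mul hKR hKB (hnn _) hKR0)
  have h := norm_rauchSymbol_apply_le_of_symmetrizer hdet A (shiftCLM A ν b - θ • B₁) hsymm₀ hsymm
    hm hcoer hN hN' τ a b'
  refine h.trans (le_of_eq ?_)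
  rw [sqrt_exp_two_mul_mul, mul_comm]
  conv_rhs => rw [mul_assoc, ← Real.exp_add]
  congr 2
  field_simp
  ring

/-- **Exponential type of the deformed affine adjoint symbols.** For a constant-coefficient system
in Rauch's class at `0` (zeroth-order term `B₁` arbitrary) there are `c₀, c₁, C ≥ 0` with
`|exp(θτE* + L_τ ξ + ib L_τ ν)ᵢⱼ| ≤ C e^{c₁|τ|} e^{2πc₀|τ| |b|}` for all `τ`, `θ ∈ [0, 1]`, `ξ`,
`‖ν‖ ≤ 1`, `b` — Brenner's bound (0.3) for the complexified symbol, the frequency shift `ibν` and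
the zeroth-order term entering as the zeroth-order term `B_b - θB₁`.
[cite: Brenner1973, (0.3) p. 75; Rauch1986, Proof of Theorem pp. 482–483] -/
theorem exists_hasExpTypeA_adjPencilB (hS : (ofConstant A₀ A B₁).IsRauchClass 0) :
    ∃ c₀ c₁ C : ℝ, 0 ≤ c₀ ∧ 0 ≤ c₁ ∧ 0 ≤ C ∧ ∀ τ : ℝ,
      HasExpTypeA ((((τ : ℝ) : ℂ)) • adjZeroth A₀ B₁) (adjPencil A₀ A τ)
        (C * Real.exp (c₁ * |τ|)) (2 * Real.pi * c₀ * |τ|) := by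
  obtain ⟨hdet, R, hRc, hR⟩ := exists_continuous_symmetrizer_family hS
  set KA : ℝ := ∑ l, ∑ i, ∑ j, |A l i j| with hKA
  set KB : ℝ := ∑ i, ∑ j, |zerothMatrix B₁ i j| with hKB
  -- constants on the unit sphere `ζ ≠ 0`
  have hKc : IsCompact (sphere (0 : Fin d → ℝ) 1) := isCompact_sphere _ _
  have hne0 : ∀ ζ ∈ sphere (0 : Fin d → ℝ) 1, ζ ≠ 0 := fun ζ hζ h0 => by
    rw [h0, mem_sphere_zero_iff_norm, norm_zero] at hζ; exact zero_ne_one hζ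
  obtain ⟨m, N, hm, hcoer, hN⟩ := exists_uniform_quadForm_bounds (k := k) hKc
    ((hRc.fun_mul continuous_const).continuousOn) (fun ζ hζ => (hR ζ (hne0 ζ hζ)).1)
  have hcontR : ContinuousOn (fun ζ => ∑ i, ∑ j, |R ζ i j|) (sphere (0 : Fin d → ℝ) 1) :=
    (continuous_finsetSum _ fun i _ => continuous_finsetSum _ fun j _ =>
      continuous_abs.comp ((continuous_apply j).comp ((continuous_apply i).comp hRc))).continuousOn
  obtain ⟨KR, hKR⟩ := hKc.bddAbove_image hcontR
  have hKR' : ∀ ζ ∈ sphere (0 : Fin d → ℝ) 1, ∑ i, ∑ j, |R ζ i j| ≤ KR :=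
    fun ζ hζ => hKR ⟨ζ, hζ, rfl⟩
  -- constants at `ξ = 0` with the symmetrizer `A₀ᵀ`
  obtain ⟨m₀, N₀, hm₀, hcoer₀, hN₀⟩ := exists_uniform_quadForm_bounds (k := k) (X := Unit)
    (K := {()}) isCompact_singleton (Q := fun _ => A₀ᵀ * A₀) continuousOn_const
    fun _ _ => posDef_transpose_mul_self hdet
  set K₀ : ℝ := ∑ i, ∑ j, |A₀ᵀ i j| with hK₀
  -- the conjugating matrices
  set SU : ℝ := ∑ a, ∑ b, ‖A₀.map (algebraMap ℝ ℂ) a b‖ with hSU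
  set SU' : ℝ := ∑ a, ∑ b, ‖(A₀⁻¹).map (algebraMap ℝ ℂ) a b‖ with hSU'
  -- the constants
  set c₁' : ℝ := KR * KA / m with hc₁'
  set c₂' : ℝ := K₀ * KA / m₀ with hc₂'
  set e₁ : ℝ := KR * KB / m with he₁
  set e₂ : ℝ := K₀ * KB / m₀ with he₂
  set C' : ℝ := max (Real.sqrt (N / m)) (Real.sqrt (N₀ / m₀)) with hC'
  have hC'0 : 0 ≤ C' := le_max_of_le_left (Real.sqrt_nonneg _)
  refine ⟨max (max c₁' c₂') 0, max (max e₁ e₂) 0, SU * C' * SU', le_max_right _ _, le_max_right _ _,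
    by positivity, fun τ θ hθ ξ ν b hν i j => ?_⟩
  rw [symMA_adjPencil_zeroth_eq hdet]
  have key : ∀ a b', ‖rauchSymbol A₀ A (shiftCLM A ν b - θ • B₁) τ ξ a b'‖ ≤
      C' * Real.exp (max (max e₁ e₂) 0 * |τ|) *
        Real.exp (2 * Real.pi * max (max c₁' c₂') 0 * |τ| * |b|) := by
    intro a b'
    have hmono : ∀ {c e S : ℝ}, c ≤ max (max c₁' c₂') 0 → e ≤ max (max e₁ e₂) 0 → S ≤ C' →
        S * Real.exp (e * |τ|) * Real.exp (2 * Real.pi * c * |τ| * |b|) ≤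
          C' * Real.exp (max (max e₁ e₂) 0 * |τ|) *
            Real.exp (2 * Real.pi * max (max c₁' c₂') 0 * |τ| * |b|) := by
      intro c e S hc he hS
      refine mul_le_mul (mul_le_mul hS (Real.exp_le_exp.2
        (mul_le_mul_of_nonneg_right he (abs_nonneg τ))) (Real.exp_pos _).le hC'0)
        (Real.exp_le_exp.2 ?_) (Real.exp_pos _).le (by positivity)
      exact mul_le_mul_of_nonneg_right (mul_le_mul_of_nonneg_right
        (mul_le_mul_of_nonneg_left hc Real.two_pi_pos.le) (abs_nonneg τ)) (abs_nonneg b)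
    rcases eq_or_ne ξ 0 with rfl | hξ
    · -- `ξ = 0`: symmetrizer `A₀ᵀ`
      have hsymm₀ : (A₀ᵀ * A₀).IsSymm := by
        show (A₀ᵀ * A₀)ᵀ = A₀ᵀ * A₀; rw [transpose_mul, transpose_transpose]
      have hsymm : (A₀ᵀ * ∑ l, (0 : Space d) l • A l).IsSymm := by
        simp [Matrix.IsSymm]
      have h := norm_rauchSymbol_shift_sub_apply_le (A := A) (B₁ := B₁) hdet hsymm₀ hsymm hm₀
        (hcoer₀ () (Set.mem_singleton _)) (hN₀ ()
          (Set.mem_singleton _)) le_rfl le_rfl hν τ b hθ a b'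
      refine h.trans ?_
      have := hmono (c := c₂') (e := e₂) (S := Real.sqrt (N₀ / m₀))
        ((le_max_right _ _).trans (le_max_left _ _)) ((le_max_right _ _).trans (le_max_left _ _))
        (le_max_right _ _)
      rw [hc₂', he₂] at this
      convert this using 3
    · -- `ξ ≠ 0`: symmetrizer `R(ζ)`, `ζ = ξ/‖ξ‖`
      have hnξ : ‖(ξ : Fin d → ℝ)‖ ≠ 0 :=
        norm_ne_zero_iff.2 fun h0 => hξ ((WithLp.ofLp_eq_zero 2).1 h0)
      set ζ : Fin d → ℝ := ‖(ξ : Fin d → ℝ)‖⁻¹ • (ξ : Fin d → ℝ) with hζ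
      have hζS : ζ ∈ sphere (0 : Fin d → ℝ) 1 := by
        rw [mem_sphere_zero_iff_norm, hζ, norm_smul, norm_inv, norm_norm, inv_mul_cancel₀ hnξ]
      have hζ0 : ζ ≠ 0 := hne0 ζ hζS
      obtain ⟨hpd, hsymm₀, hsymmζ⟩ := hR ζ hζ0
      have hsymm : (R ζ * ∑ l, ξ l • A l).IsSymm := by
        have hsum : ∑ l, ξ l • A l = ‖(ξ : Fin d → ℝ)‖ • ∑ l, ζ l • A l := by
          rw [Finset.smul_sum]
          refine Finset.sum_congr rfl fun l _ => ?_
          rw [smul_smul, hζ, Pi.smul_apply, smul_eq_mul, ← mul_assoc, mul_inv_cancel₀ hnξ, one_mul]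
        rw [hsum, Matrix.mul_smul]
        exact hsymmζ.smul _
      have h := norm_rauchSymbol_shift_sub_apply_le (A := A) (B₁ := B₁) hdet hsymm₀ hsymm hm
        (hcoer ζ hζS) (hN ζ hζS) (hKR' ζ hζS) le_rfl hν τ b hθ a b'
      refine h.trans ?_
      have := hmono (c := c₁') (e := e₁) (S := Real.sqrt (N / m))
        ((le_max_left _ _).trans (le_max_left _ _)) ((le_max_left _ _).trans (le_max_left _ _))
        (le_max_left _ _)
      rw [hc₁', he₁] at this
      convert this using 3
  refine (norm_transpose_conj_apply_le _ _ _ key i j).trans (le_of_eq ?_)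
  rw [hSU, hSU']
  ring

end AdjointZeroth

/-! ### The adjoint evolution as a Fourier multiplier -/

section AdjointSolution

variable {A₀ : Matrix (Fin k) (Fin k) ℝ} {A : Fin d → Matrix (Fin k) (Fin k) ℝ}
  {B₁ : (Fin k → ℝ) →L[ℝ] (Fin k → ℝ)}

/-- The generator of the adjoint evolution with zeroth-order term,
`H*(ξ) = E* - G*(ξ) = (A₀⁻¹)ᵀ_ℂ (B₁ᵀ_ℂ - 2πi Σ ξ_l
  (A_l)ᵀ_ℂ)`: the Fourier transform of a solution of
`A₀ᵀ∂ₜw + Σ Aⱼᵀ∂ⱼw - B₁ᵀw = 0` obeys `∂ₜŵ = H*(ξ)ŵ`. [cite: Rauch1986, Proof of Theorem p. 483] -/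
def adjGenB (A₀ : Matrix (Fin k) (Fin k) ℝ) (A : Fin d → Matrix (Fin k) (Fin k) ℝ)
    (B₁ : (Fin k → ℝ) →L[ℝ] (Fin k → ℝ)) (ξ : Space d) : Matrix (Fin k) (Fin k) ℂ :=
  adjZeroth A₀ B₁ - adjGen A₀ A ξ

/-- The symbol of the adjoint evolution from time `t₀` to time `t`:
`M*_{t₀,t}(ξ) = exp((t - t₀)E* + L_{t-t₀} ξ) = e^{(t-t₀)H*(ξ)}` — the exponential of an AFFINE
pencil. [cite: Rauch1986, Proof of Theorem p. 483] -/
def adjSymB (A₀ : Matrix (Fin k) (Fin k) ℝ) (A : Fin d → Matrix (Fin k) (Fin k) ℝ)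
    (B₁ : (Fin k → ℝ) →L[ℝ] (Fin k → ℝ)) (t₀ t : ℝ) (ξ : Space d) : Matrix (Fin k) (Fin k) ℂ :=
  NormedSpace.exp ((((t - t₀ : ℝ) : ℂ)) • adjZeroth A₀ B₁ + adjPencil A₀ A (t - t₀) ξ)

/-- **The adjoint solution** `w(t) = M*_{t₀,t}(D)ψ`: the solution of the adjoint system
`A₀ᵀ∂ₜw + Σ Aⱼᵀ∂ⱼw - B₁ᵀw = 0` with `w(t₀) = ψ`, written as a Fourier multiplier.
[cite: Rauch1986, Proof of Theorem p. 483] -/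
def adjSolB (A₀ : Matrix (Fin k) (Fin k) ℝ) (A : Fin d → Matrix (Fin k) (Fin k) ℝ)
    (B₁ : (Fin k → ℝ) →L[ℝ] (Fin k → ℝ)) (t₀ : ℝ) (ψ : Space d → Fin k → ℂ) (t : ℝ) (x : Space d) :
    Fin k → ℂ :=
  multiplierOp (adjSymB A₀ A B₁ t₀ t) ψ x

/-- `M*_{t₀,t}(ξ) = exp((t - t₀) • H*(ξ))`. [folklore] -/
theorem adjSymB_eq (t₀ t : ℝ) (ξ : Space d) :
    adjSymB A₀ A B₁ t₀ t ξ = NormedSpace.exp ((t - t₀) • adjGenB A₀ A B₁ ξ) := by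
  rw [adjSymB, adjGenB, adjPencil_apply, ← Complex.coe_smul, smul_sub, neg_smul, ← sub_eq_add_neg]

/-- The symbol is the affine symbol `symMA ((t - t₀)E*) L_{t-t₀} ν 0`. [folklore] -/
theorem adjSymB_eq_symMA (t₀ t : ℝ) (ν ξ : Space d) :
    adjSymB A₀ A B₁ t₀ t ξ =
      symMA ((((t - t₀ : ℝ) : ℂ)) • adjZeroth A₀ B₁) (adjPencil A₀ A (t - t₀)) ν 0 ξ := by
  rw [adjSymB, symMA_zero_right]

/-- At `t = t₀` the symbol is `1`. [folklore] -/
theorem adjSymB_self (t₀ : ℝ) (ξ : Space d) : adjSymB A₀ A B₁ t₀ t₀ ξ = 1 := by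
  rw [adjSymB_eq, sub_self, zero_smul, NormedSpace.exp_zero]

/-- The symbol is continuous in `ξ`. [folklore] -/
theorem continuous_adjSymB (t₀ t : ℝ) : Continuous (adjSymB A₀ A B₁ t₀ t) :=
  NormedSpace.exp_continuous.comp (continuous_const.add (adjPencil A₀ A (t - t₀)).continuous)

/-- Entries of the symbol are measurable in `ξ`. [folklore] -/
theorem measurable_adjSymB_apply (t₀ t : ℝ) (a b : Fin k) :
    Measurable fun ξ => adjSymB A₀ A B₁ t₀ t ξ a b :=
  ((continuous_apply b).comp ((continuous_apply a).comp (continuous_adjSymB t₀ t))).measurable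

/-- **Bound for the symbol**: under the exponential-type hypothesis the symbol is entrywise
bounded by `C e^{c₁|t - t₀|}`, uniformly in `ξ` (the zeroth-order term makes the bound grow in
time). [cite: Brenner1973, (0.3) p. 75] -/
theorem norm_adjSymB_apply_le {C c₀ c₁ : ℝ}
    (hT : ∀ τ : ℝ, HasExpTypeA (((τ : ℝ) : ℂ) • adjZeroth A₀ B₁) (adjPencil A₀ A τ)
      (C * Real.exp (c₁ * |τ|)) (2 * Real.pi * c₀ * |τ|))
    (t₀ t : ℝ) (ξ : Space d) (a b : Fin k) :
    ‖adjSymB A₀ A B₁ t₀ t ξ a b‖ ≤ C * Real.exp (c₁ * |t - t₀|) := by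
  have h := hT (t - t₀) 1 ⟨zero_le_one, le_rfl⟩ ξ 0 0 (by simp) a b
  rw [abs_zero, mul_zero, Real.exp_zero, mul_one, Complex.ofReal_one, one_smul,
    ← adjSymB_eq_symMA t₀ t 0 ξ] at h
  exact h

/-- The time-dependent bound is monotone: for `|t - t₀| ≤ S`, `C e^{c₁|t-t₀|} ≤ C e^{c₁S}`.
[folklore] -/
theorem timeConst_le {C c₁ S t₀ t : ℝ} (hC : 0 ≤ C) (hc₁ : 0 ≤ c₁) (h : |t - t₀| ≤ S) :
    C * Real.exp (c₁ * |t - t₀|) ≤ C * Real.exp (c₁ * S) :=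
  mul_le_mul_of_nonneg_left (Real.exp_le_exp.2 (mul_le_mul_of_nonneg_left h hc₁)) hC

/-- **Time derivative of the symbol**: `∂ₜ M*_{t₀,t}(ξ) = H*(ξ) M*_{t₀,t}(ξ)`. [folklore] -/
theorem hasDerivAt_adjSymB (t₀ t : ℝ) (ξ : Space d) :
    HasDerivAt (fun s => adjSymB A₀ A B₁ t₀ s ξ)
      (adjGenB A₀ A B₁ ξ * adjSymB A₀ A B₁ t₀ t ξ) t := by
  have hfun : (fun s => adjSymB A₀ A B₁ t₀ s ξ) =
      fun s => NormedSpace.exp ((s - t₀) • adjGenB A₀ A B₁ ξ) := funext fun s => adjSymB_eq t₀ s ξ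
  rw [hfun, adjSymB_eq]
  have h1 := hasDerivAt_exp_smul_const' (𝕂 := ℝ) (adjGenB A₀ A B₁ ξ) (t - t₀)
  have h2 : HasDerivAt (fun s : ℝ => s - t₀) 1 t := by
    simpa using (hasDerivAt_id t).sub_const t₀
  have h := h1.scomp t h2
  have h' : HasDerivAt (fun s => NormedSpace.exp ((s - t₀) • adjGenB A₀ A B₁ ξ))
      ((1 : ℝ) • (adjGenB A₀ A B₁ ξ * NormedSpace.exp ((t - t₀) • adjGenB A₀ A B₁ ξ))) t := h
  simpa using h'

/-- **Finite propagation for the adjoint solution**: if `ψ ∈ C_c^∞` is supported in `B̄(x₀, r)`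
then `w(t, x) = 0` for `‖x - x₀‖ > r + c₀|t - t₀|` (the affine Paley–Wiener deformation theorem
`multiplierOp_expAffine_apply_eq_zero_of_dist`). [cite: Rauch1986, Proof of Theorem p. 482] -/
theorem adjSolB_eq_zero {C c₀ c₁ : ℝ} (hC : 0 ≤ C) (hc₀ : 0 ≤ c₀)
    (hT : ∀ τ : ℝ, HasExpTypeA (((τ : ℝ) : ℂ) • adjZeroth A₀ B₁) (adjPencil A₀ A τ)
      (C * Real.exp (c₁ * |τ|)) (2 * Real.pi * c₀ * |τ|))
    {ψ : Space d → Fin k → ℂ} (hψ : ContDiff ℝ ∞ ψ) (hc : HasCompactSupport ψ) {x₀ : Space d}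
    {r : ℝ} (hr : 0 ≤ r) (hsupp : tsupport ψ ⊆ closedBall x₀ r) (t₀ t : ℝ) {x : Space d}
    (hx : r + c₀ * |t - t₀| < ‖x - x₀‖) : adjSolB A₀ A B₁ t₀ ψ t x = 0 := by
  have hγ : 0 ≤ 2 * Real.pi * c₀ * |t - t₀| := by positivity
  have hC' : 0 ≤ C * Real.exp (c₁ * |t - t₀|) := by positivity
  have h := multiplierOp_expAffine_apply_eq_zero_of_dist (hT (t - t₀)) hC' hγ hψ hc hr hsupp
    (x := x)
    (by rwa [show 2 * Real.pi * c₀ * |t - t₀| / (2 * Real.pi) = c₀ * |t - t₀| by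
      field_simp])
  exact h

/-- **`w(t₀) = ψ`** (Fourier inversion). [folklore] -/
theorem adjSolB_self {ψ : Space d → Fin k → ℂ} (hψ : ContDiff ℝ ∞ ψ) (hc : HasCompactSupport ψ)
    (t₀ : ℝ) (x : Space d) : adjSolB A₀ A B₁ t₀ ψ t₀ x = ψ x := by
  rw [adjSolB, multiplierOp_apply]
  have h1 : (fun ξ => adjSymB A₀ A B₁ t₀ t₀ ξ *ᵥ 𝓕 ψ ξ) = 𝓕 ψ := by
    funext ξ; rw [adjSymB_self, Matrix.one_mulVec]
  rw [h1, hψ.continuous.fourierInv_fourier_eq (hψ.continuous.integrable_of_hasCompactSupport hc)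
    (integrable_fourier_of_contDiff hψ hc)]

/-- **Spatial derivatives of the adjoint solution**: `∂ᵥw(t) = M*_{t₀,t}(D)(∂ᵥψ)`, and `w(t)` is
differentiable. [folklore] -/
theorem fderiv_adjSolB_apply {C c₀ c₁ : ℝ} (hC : 0 ≤ C)
    (hT : ∀ τ : ℝ, HasExpTypeA (((τ : ℝ) : ℂ) • adjZeroth A₀ B₁) (adjPencil A₀ A τ)
      (C * Real.exp (c₁ * |τ|)) (2 * Real.pi * c₀ * |τ|))
    {ψ : Space d → Fin k → ℂ} (hψ : ContDiff ℝ ∞ ψ) (hc : HasCompactSupport ψ) (t₀ t : ℝ)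
    (x v : Space d) :
    fderiv ℝ (adjSolB A₀ A B₁ t₀ ψ t) x v =
      multiplierOp (adjSymB A₀ A B₁ t₀ t) (fun y => fderiv ℝ ψ y v) x :=
  fderiv_multiplierOp_apply_of_contDiff (measurable_adjSymB_apply t₀ t) (by positivity)
    (norm_adjSymB_apply_le hT t₀ t) hψ hc x v

/-- `w(t)` is differentiable in `x`. [folklore] -/
theorem differentiable_adjSolB {C c₀ c₁ : ℝ} (hC : 0 ≤ C)
    (hT : ∀ τ : ℝ, HasExpTypeA (((τ : ℝ) : ℂ) • adjZeroth A₀ B₁) (adjPencil A₀ A τ)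
      (C * Real.exp (c₁ * |τ|)) (2 * Real.pi * c₀ * |τ|))
    {ψ : Space d → Fin k → ℂ} (hψ : ContDiff ℝ ∞ ψ) (hc : HasCompactSupport ψ) (t₀ t : ℝ) :
    Differentiable ℝ (adjSolB A₀ A B₁ t₀ ψ t) :=
  differentiable_multiplierOp_of_contDiff (measurable_adjSymB_apply t₀ t) (by positivity)
    (norm_adjSymB_apply_le hT t₀ t) hψ hc

/-! ### The time derivative of the adjoint solution and the adjoint equation -/

/-- The Fourier-side time derivative `(H*(ξ) M*_{t₀,t}(ξ)) 𝓕ψ(ξ)`. [folklore] -/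
def adjSolDtFB (A₀ : Matrix (Fin k) (Fin k) ℝ) (A : Fin d → Matrix (Fin k) (Fin k) ℝ)
    (B₁ : (Fin k → ℝ) →L[ℝ] (Fin k → ℝ)) (t₀ : ℝ) (ψ : Space d → Fin k → ℂ) (t : ℝ) (ξ : Space d) :
    Fin k → ℂ :=
  (adjGenB A₀ A B₁ ξ * adjSymB A₀ A B₁ t₀ t ξ) *ᵥ 𝓕 ψ ξ

/-- The time derivative of the adjoint solution, `∂ₜw(t, x) = 𝓕⁻¹[(H* M*) 𝓕ψ](x)`.
[folklore] -/
def adjSolDtB (A₀ : Matrix (Fin k) (Fin k) ℝ) (A : Fin d → Matrix (Fin k) (Fin k) ℝ)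
    (B₁ : (Fin k → ℝ) →L[ℝ] (Fin k → ℝ)) (t₀ : ℝ) (ψ : Space d → Fin k → ℂ) (t : ℝ) (x : Space d) :
    Fin k → ℂ :=
  𝓕⁻ (adjSolDtFB A₀ A B₁ t₀ ψ t) x

/-- Operator norm of the symbol: `‖M*_{t₀,t}(ξ)‖ ≤ kC e^{c₁|t-t₀|}`. [folklore] -/
theorem norm_adjSymB_le {C c₀ c₁ : ℝ} (hC : 0 ≤ C)
    (hT : ∀ τ : ℝ, HasExpTypeA (((τ : ℝ) : ℂ) • adjZeroth A₀ B₁) (adjPencil A₀ A τ)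
      (C * Real.exp (c₁ * |τ|)) (2 * Real.pi * c₀ * |τ|))
    (t₀ t : ℝ) (ξ : Space d) : ‖adjSymB A₀ A B₁ t₀ t ξ‖ ≤ k * (C * Real.exp (c₁ * |t - t₀|)) :=
  linfty_opNorm_le_of_entry_le (by positivity) (norm_adjSymB_apply_le hT t₀ t ξ)

/-- `‖H*(ξ)‖ ≤ ‖E*‖ + K_G ‖ξ‖`. [folklore] -/
theorem norm_adjGenB_le (ξ : Space d) :
    ‖adjGenB A₀ A B₁ ξ‖ ≤ ‖adjZeroth A₀ B₁‖ + adjGenBound A₀ A * ‖ξ‖ := by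
  rw [adjGenB]
  exact (norm_sub_le _ _).trans (add_le_add le_rfl (norm_adjGen_le A₀ A ξ))

/-- Pointwise bound for the Fourier-side time derivative:
`‖(H*M*)𝓕ψ(ξ)‖ ≤ kC e^{c₁|t-t₀|} (‖E*‖ + K_G ‖ξ‖) ‖𝓕ψ(ξ)‖`. [folklore] -/
theorem norm_adjSolDtFB_le {C c₀ c₁ : ℝ} (hC : 0 ≤ C)
    (hT : ∀ τ : ℝ, HasExpTypeA (((τ : ℝ) : ℂ) • adjZeroth A₀ B₁) (adjPencil A₀ A τ)
      (C * Real.exp (c₁ * |τ|)) (2 * Real.pi * c₀ * |τ|))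
    (t₀ : ℝ) (ψ : Space d → Fin k → ℂ) (t : ℝ) (ξ : Space d) :
    ‖adjSolDtFB A₀ A B₁ t₀ ψ t ξ‖ ≤ (k * (C * Real.exp (c₁ * |t - t₀|))) *
      (‖adjZeroth A₀ B₁‖ * ‖𝓕 ψ ξ‖ + adjGenBound A₀ A * (‖ξ‖ * ‖𝓕 ψ ξ‖)) := by
  rw [adjSolDtFB]
  refine (Matrix.linfty_opNorm_mulVec _ _).trans ?_
  have h1 : ‖adjGenB A₀ A B₁ ξ * adjSymB A₀ A B₁ t₀ t ξ‖ ≤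
      (‖adjZeroth A₀ B₁‖ + adjGenBound A₀ A * ‖ξ‖) * (k * (C * Real.exp (c₁ * |t - t₀|))) :=
    (Matrix.linfty_opNorm_mul _ _).trans (mul_le_mul (norm_adjGenB_le ξ)
      (norm_adjSymB_le hC hT t₀ t ξ) (norm_nonneg _)
      (add_nonneg (norm_nonneg _) (mul_nonneg (adjGenBound_nonneg A₀ A) (norm_nonneg _))))
  calc ‖adjGenB A₀ A B₁ ξ * adjSymB A₀ A B₁ t₀ t ξ‖ * ‖𝓕 ψ ξ‖
      ≤ (‖adjZeroth A₀ B₁‖ + adjGenBound A₀ A * ‖ξ‖) * (k * (C * Real.exp (c₁ * |t - t₀|))) *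
          ‖𝓕 ψ ξ‖ := mul_le_mul_of_nonneg_right h1 (norm_nonneg _)
    _ = _ := by ring

/-- The Fourier-side time derivative is continuous in `ξ`. [folklore] -/
theorem continuous_adjSolDtFB {ψ : Space d → Fin k → ℂ} (hψ : ContDiff ℝ ∞ ψ)
    (hc : HasCompactSupport ψ) (t₀ t : ℝ) : Continuous (adjSolDtFB A₀ A B₁ t₀ ψ t) := by
  unfold adjSolDtFB
  have h1 : Continuous fun ξ => adjGenB A₀ A B₁ ξ * adjSymB A₀ A B₁ t₀ t ξ :=
    (continuous_const.sub (adjGen A₀ A).continuous).mul (continuous_adjSymB t₀ t)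
  have h2 : Continuous (𝓕 ψ) := by
    have := (𝓕 (hc.toSchwartzMap hψ)).continuous
    rwa [SchwartzMap.fourier_coe] at this
  exact (mulVecBilin (k := k)).continuous₂.comp (h1.prodMk h2)

/-- The majorant `K (‖E*‖ ‖𝓕ψ‖ + K_G ‖ξ‖‖𝓕ψ‖)` is integrable for `ψ ∈ C_c^∞`. [folklore] -/
theorem integrable_dtMajorant {ψ : Space d → Fin k → ℂ} (hψ : ContDiff ℝ ∞ ψ)
    (hc : HasCompactSupport ψ) (K : ℝ) :
    Integrable fun ξ : Space d =>
      K * (‖adjZeroth A₀ B₁‖ * ‖𝓕 ψ ξ‖ + adjGenBound A₀ A * (‖ξ‖ * ‖𝓕 ψ ξ‖)) :=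
  ((((integrable_fourier_of_contDiff hψ hc).norm.const_mul _).add
    ((integrable_norm_mul_norm_fourier hψ hc).const_mul _)).const_mul K)

/-- The Fourier-side time derivative is integrable. [folklore] -/
theorem integrable_adjSolDtFB {C c₀ c₁ : ℝ} (hC : 0 ≤ C)
    (hT : ∀ τ : ℝ, HasExpTypeA (((τ : ℝ) : ℂ) • adjZeroth A₀ B₁) (adjPencil A₀ A τ)
      (C * Real.exp (c₁ * |τ|)) (2 * Real.pi * c₀ * |τ|))
    {ψ : Space d → Fin k → ℂ} (hψ : ContDiff ℝ ∞ ψ) (hc : HasCompactSupport ψ) (t₀ t : ℝ) :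
    Integrable (adjSolDtFB A₀ A B₁ t₀ ψ t) :=
  (integrable_dtMajorant (A₀ := A₀) (A := A) (B₁ := B₁) hψ hc _).mono'
    (continuous_adjSolDtFB hψ hc t₀ t).aestronglyMeasurable
    (Eventually.of_forall fun ξ => norm_adjSolDtFB_le hC hT t₀ ψ t ξ)

/-- `M*_{t₀,t} 𝓕ψ` is integrable. [folklore] -/
theorem integrable_adjSymB_mulVec_fourier {C c₀ c₁ : ℝ} (hC : 0 ≤ C)
    (hT : ∀ τ : ℝ, HasExpTypeA (((τ : ℝ) : ℂ) • adjZeroth A₀ B₁) (adjPencil A₀ A τ)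
      (C * Real.exp (c₁ * |τ|)) (2 * Real.pi * c₀ * |τ|))
    {ψ : Space d → Fin k → ℂ} (hψ : ContDiff ℝ ∞ ψ) (hc : HasCompactSupport ψ) (t₀ t : ℝ) :
    Integrable fun ξ => adjSymB A₀ A B₁ t₀ t ξ *ᵥ 𝓕 ψ ξ :=
  integrable_mulVec_fourier (measurable_adjSymB_apply t₀ t) (by positivity)
    (norm_adjSymB_apply_le hT t₀ t) (hc.toSchwartzMap hψ)

/-- **Time derivative of the adjoint solution** (differentiation under the inverse Fourier
integral, dominated on `|s - t| < 1` by `kC e^{c₁(|t-t₀|+1)} (‖E*‖ + K_G‖ξ‖) ‖𝓕ψ(ξ)‖`):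
`∂ₜw(t, x) = 𝓕⁻¹[(H*M*)𝓕ψ](x)`. [folklore] -/
theorem hasDerivAt_adjSolB {C c₀ c₁ : ℝ} (hC : 0 ≤ C) (hc₁ : 0 ≤ c₁)
    (hT : ∀ τ : ℝ, HasExpTypeA (((τ : ℝ) : ℂ) • adjZeroth A₀ B₁) (adjPencil A₀ A τ)
      (C * Real.exp (c₁ * |τ|)) (2 * Real.pi * c₀ * |τ|))
    {ψ : Space d → Fin k → ℂ} (hψ : ContDiff ℝ ∞ ψ) (hc : HasCompactSupport ψ) (t₀ : ℝ)
    (x : Space d) (t : ℝ) :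
    HasDerivAt (fun s => adjSolB A₀ A B₁ t₀ ψ s x) (adjSolDtB A₀ A B₁ t₀ ψ t x) t := by
  -- the phase
  set E : Space d → ℂ := fun ξ => Complex.exp (((2 * Real.pi * ⟪ξ, x⟫ : ℝ) : ℂ) * I) with hE
  have hEn : ∀ ξ, ‖E ξ‖ = 1 := fun ξ => by rw [hE]; exact Complex.norm_exp_ofReal_mul_I _
  have hEc : Continuous E := Complex.continuous_exp.comp ((Complex.continuous_ofReal.comp
    (continuous_const.mul (continuous_id.inner continuous_const))).mul continuous_const)
  -- the integrands
  set F : ℝ → Space d → Fin k → ℂ := fun s ξ => E ξ • (adjSymB A₀ A B₁ t₀ s ξ *ᵥ 𝓕 ψ ξ) with hF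
  set F' : ℝ → Space d → Fin k → ℂ := fun s ξ => E ξ • adjSolDtFB A₀ A B₁ t₀ ψ s ξ with hF'
  have hψF : Continuous (𝓕 ψ) := by
    have := (𝓕 (hc.toSchwartzMap hψ)).continuous
    rwa [SchwartzMap.fourier_coe] at this
  have hFc : ∀ s, Continuous (F s) := fun s =>
    hEc.smul ((mulVecBilin (k := k)).continuous₂.comp ((continuous_adjSymB t₀ s).prodMk hψF))
  have hF'c : ∀ s, Continuous (F' s) := fun s => hEc.smul (continuous_adjSolDtFB hψ hc t₀ s)
  have hFi : Integrable (F t) := by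
    refine (integrable_adjSymB_mulVec_fourier hC hT hψ hc t₀ t).norm.mono'
      (hFc t).aestronglyMeasurable
      (Eventually.of_forall fun ξ => ?_)
    rw [hF]
    simp only [norm_smul, hEn, one_mul, le_refl]
  -- the uniform constant on the ball `|s - t| < 1`
  have hball : ∀ s ∈ ball t 1, C * Real.exp (c₁ * |s - t₀|) ≤ C * Real.exp (c₁ * (|t - t₀| + 1)) :=
    fun s hs => timeConst_le hC hc₁ (by
      have h1 : |s - t| < 1 := by simpa [Real.dist_eq] using mem_ball.1 hs
      have h2 := abs_sub_le s t t₀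
      have h3 : |s - t₀| ≤ |s - t| + |t - t₀| := abs_sub_le s t t₀
      linarith)
  have key := hasDerivAt_integral_of_dominated_loc_of_deriv_le (μ := (volume : Measure (Space d)))
    (F := F) (F' := F') (x₀ := t) (s := ball t 1) (ball_mem_nhds t one_pos)
    (Eventually.of_forall fun s => (hFc s).aestronglyMeasurable) hFi
    (hF'c t).aestronglyMeasurable
    (Eventually.of_forall fun ξ s hs => ?_)
    (integrable_dtMajorant (A₀ := A₀) (A := A) (B₁ := B₁) hψ hc (k * (C * Real.exp (c₁ *
      (|t - t₀| + 1)))))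
    (Eventually.of_forall fun ξ s _ => ?_)
  · -- identify the integrals
    have h1 : (fun s => adjSolB A₀ A B₁ t₀ ψ s x) = fun s => ∫ ξ, F s ξ := by
      funext s
      rw [adjSolB, multiplierOp_apply, Real.fourierInv_eq']
    have h2 : adjSolDtB A₀ A B₁ t₀ ψ t x = ∫ ξ, F' t ξ := by
      rw [adjSolDtB, Real.fourierInv_eq']
    rw [h1, h2]
    exact key.2
  · -- domination
    rw [hF', norm_smul, hEn, one_mul]
    refine (norm_adjSolDtFB_le hC hT t₀ ψ s ξ).trans ?_
    refine mul_le_mul_of_nonneg_right (mul_le_mul_of_nonneg_left (hball s hs)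
      (Nat.cast_nonneg k)) ?_
    exact add_nonneg (mul_nonneg (norm_nonneg _) (norm_nonneg _))
      (mul_nonneg (adjGenBound_nonneg A₀ A) (mul_nonneg (norm_nonneg _) (norm_nonneg _)))
  · -- pointwise derivative in `s`
    simp only [hF, hF', adjSolDtFB]
    have h := hasDerivAt_smul_mulVec (hasDerivAt_const s (E ξ))
      (hasDerivAt_adjSymB (A₀ := A₀) (A := A) (B₁ := B₁) t₀ s ξ) (hasDerivAt_const s (𝓕 ψ ξ))
    simpa using h

/-- **The zeroth-order term through `A₀ᵀ`**: `A₀ᵀ_ℂ E* = B₁ᵀ_ℂ` (`A₀ᵀ (A₀⁻¹)ᵀ = 1`). [folklore] -/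
theorem transpose_map_mul_adjZeroth (hdet : A₀.det ≠ 0) :
    (A₀ᵀ).map (algebraMap ℝ ℂ) * adjZeroth A₀ B₁ =
      ((LinearMap.toMatrix' (B₁ : (Fin k → ℝ) →ₗ[ℝ] (Fin k → ℝ)))ᵀ).map (algebraMap ℝ ℂ) := by
  rw [adjZeroth, ← Matrix.mul_assoc, ← Matrix.map_mul, ← transpose_mul,
    nonsing_inv_mul _ (isUnit_iff_ne_zero.2 hdet), transpose_one,
    Matrix.map_one _ (map_zero _) (map_one _), Matrix.one_mul]

/-- **The adjoint equation in Fourier variables**: for every `ξ`,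
`A₀ᵀ_ℂ (H*M*𝓕ψ)(ξ) + Σⱼ (Aⱼ)ᵀ_ℂ M* 𝓕(∂ⱼψ)(ξ) - B₁ᵀ_ℂ M*𝓕ψ(ξ) = 0`.
[cite: Rauch1986, Proof of Theorem p. 483] -/
theorem adjoint_eqn_fourierSideB (hdet : A₀.det ≠ 0) {ψ : Space d → Fin k → ℂ}
    (hψ : ContDiff ℝ ∞ ψ) (hc : HasCompactSupport ψ) (t₀ t : ℝ) (ξ : Space d) :
    (A₀ᵀ).map (algebraMap ℝ ℂ) *ᵥ adjSolDtFB A₀ A B₁ t₀ ψ t ξ +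
      ∑ j, ((A j)ᵀ).map (algebraMap ℝ ℂ) *ᵥ (adjSymB A₀ A B₁ t₀ t ξ *ᵥ
        𝓕 (fun y => fderiv ℝ ψ y (EuclideanSpace.single j 1)) ξ) -
      ((LinearMap.toMatrix' (B₁ : (Fin k → ℝ) →ₗ[ℝ] (Fin k → ℝ)))ᵀ).map (algebraMap ℝ ℂ) *ᵥ
        (adjSymB A₀ A B₁ t₀ t ξ *ᵥ 𝓕 ψ ξ) = 0 := by
  have hfd : ∀ j, 𝓕 (fun y => fderiv ℝ ψ y (EuclideanSpace.single j 1)) ξ =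
      (2 * Real.pi * ξ j * Complex.I) • 𝓕 ψ ξ :=
    fun j => fourier_fderiv_apply_single (hψ.of_le (by exact_mod_cast le_top)) hc ξ j
  simp_rw [hfd, Matrix.mulVec_smul, adjSolDtFB, Matrix.mulVec_mulVec, ← Matrix.smul_mulVec,
    ← Matrix.sum_mulVec, ← Matrix.add_mulVec, ← Matrix.sub_mulVec]
  rw [← Matrix.mul_assoc, adjGenB, Matrix.mul_sub, transpose_map_mul_adjZeroth hdet,
    transpose_map_mul_adjGen hdet, Matrix.sub_mul, Finset.sum_mul]
  simp_rw [Matrix.smul_mul]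
  rw [sub_add_cancel, sub_self, Matrix.zero_mulVec]

/-- `x ↦ ∂ₜw(t, x)` is continuous. [folklore] -/
theorem continuous_adjSolDtB {C c₀ c₁ : ℝ} (hC : 0 ≤ C)
    (hT : ∀ τ : ℝ, HasExpTypeA (((τ : ℝ) : ℂ) • adjZeroth A₀ B₁) (adjPencil A₀ A τ)
      (C * Real.exp (c₁ * |τ|)) (2 * Real.pi * c₀ * |τ|))
    {ψ : Space d → Fin k → ℂ} (hψ : ContDiff ℝ ∞ ψ) (hc : HasCompactSupport ψ) (t₀ t : ℝ) :
    Continuous (adjSolDtB A₀ A B₁ t₀ ψ t) :=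
  continuous_fourierInv_of_integrable (integrable_adjSolDtFB hC hT hψ hc t₀ t)

/-- **The adjoint equation**: `A₀ᵀ_ℂ ∂ₜw(t, x) + Σⱼ (Aⱼ)ᵀ_ℂ ∂ⱼw(t, x) - B₁ᵀ_ℂ w(t, x) = 0` for all
`t, x`. [cite: Rauch1986, Proof of Theorem p. 483] -/
theorem adjoint_eqnB (hdet : A₀.det ≠ 0) {C c₀ c₁ : ℝ} (hC : 0 ≤ C)
    (hT : ∀ τ : ℝ, HasExpTypeA (((τ : ℝ) : ℂ) • adjZeroth A₀ B₁) (adjPencil A₀ A τ)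
      (C * Real.exp (c₁ * |τ|)) (2 * Real.pi * c₀ * |τ|))
    {ψ : Space d → Fin k → ℂ} (hψ : ContDiff ℝ ∞ ψ) (hc : HasCompactSupport ψ) (t₀ t : ℝ)
    (x : Space d) :
    (A₀ᵀ).map (algebraMap ℝ ℂ) *ᵥ adjSolDtB A₀ A B₁ t₀ ψ t x +
      ∑ j, ((A j)ᵀ).map (algebraMap ℝ ℂ) *ᵥ
        fderiv ℝ (adjSolB A₀ A B₁ t₀ ψ t) x (EuclideanSpace.single j 1) -
      ((LinearMap.toMatrix' (B₁ : (Fin k → ℝ) →ₗ[ℝ] (Fin k → ℝ)))ᵀ).map (algebraMap ℝ ℂ) *ᵥ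
        adjSolB A₀ A B₁ t₀ ψ t x = 0 := by
  -- the spatial derivatives as multiplier outputs
  have hψj : ∀ j, ContDiff ℝ ∞ fun y => fderiv ℝ ψ y (EuclideanSpace.single j 1) := fun j =>
    (hψ.fderiv_right (m := ∞) (by exact_mod_cast le_top)).clm_apply contDiff_const
  have hcj : ∀ j, HasCompactSupport fun y => fderiv ℝ ψ y (EuclideanSpace.single j 1) :=
    fun j => (hc.fderiv ℝ).comp_left (g := fun L : Space d →L[ℝ] (Fin k → ℂ) =>
      L (EuclideanSpace.single j 1)) rfl
  set gj : Fin d → Space d → Fin k → ℂ := fun j ξ => adjSymB A₀ A B₁ t₀ t ξ *ᵥ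
    𝓕 (fun y => fderiv ℝ ψ y (EuclideanSpace.single j 1)) ξ with hgj
  have hgi : ∀ j, Integrable (gj j) := fun j =>
    integrable_mulVec_fourier (measurable_adjSymB_apply t₀ t) (by positivity)
      (norm_adjSymB_apply_le hT t₀ t) ((hcj j).toSchwartzMap (hψj j))
  have hfd : ∀ j, fderiv ℝ (adjSolB A₀ A B₁ t₀ ψ t) x (EuclideanSpace.single j 1) = 𝓕⁻
    (gj j) x := by
    intro j
    rw [fderiv_adjSolB_apply hC hT hψ hc t₀ t x, multiplierOp_apply]
  simp_rw [hfd]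
  -- the zeroth-order output
  set g0 : Space d → Fin k → ℂ := fun ξ => adjSymB A₀ A B₁ t₀ t ξ *ᵥ 𝓕 ψ ξ with hg0
  have hg0i : Integrable g0 := integrable_adjSymB_mulVec_fourier hC hT hψ hc t₀ t
  have hw : adjSolB A₀ A B₁ t₀ ψ t x = 𝓕⁻ g0 x := by rw [adjSolB, multiplierOp_apply]
  rw [hw]
  -- pull the constant matrices inside and add up
  have hdt := integrable_adjSolDtFB hC hT hψ hc t₀ t (A₀ := A₀) (A := A) (B₁ := B₁)
  set Bt : Matrix (Fin k) (Fin k) ℂ :=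
    ((LinearMap.toMatrix' (B₁ : (Fin k → ℝ) →ₗ[ℝ] (Fin k → ℝ)))ᵀ).map (algebraMap ℝ ℂ) with hBt
  rw [adjSolDtB, ← congrFun (fourierInv_mulVec ((A₀ᵀ).map (algebraMap ℝ ℂ)) hdt) x,
    ← congrFun (fourierInv_mulVec Bt hg0i) x]
  have hsum : ∀ j, ((A j)ᵀ).map (algebraMap ℝ ℂ) *ᵥ 𝓕⁻ (gj j) x =
      𝓕⁻ (fun ξ => ((A j)ᵀ).map (algebraMap ℝ ℂ) *ᵥ gj j ξ) x :=
    fun j => (congrFun (fourierInv_mulVec (((A j)ᵀ).map (algebraMap ℝ ℂ)) (hgi j)) x).symm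
  simp_rw [hsum, Real.fourierInv_eq_fourier_neg]
  have hi1 : Integrable fun ξ => (A₀ᵀ).map (algebraMap ℝ ℂ) *ᵥ adjSolDtFB A₀ A B₁ t₀ ψ t ξ := by
    simpa using (mulVecBilin ((A₀ᵀ).map (algebraMap ℝ ℂ))).integrable_comp hdt
  have hi2 : ∀ j, Integrable fun ξ => ((A j)ᵀ).map (algebraMap ℝ ℂ) *ᵥ gj j ξ := fun j => by
    simpa using (mulVecBilin (((A j)ᵀ).map (algebraMap ℝ ℂ))).integrable_comp (hgi j)
  have hi3 : Integrable fun ξ => Bt *ᵥ g0 ξ := by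
    simpa using (mulVecBilin Bt).integrable_comp hg0i
  have hi12 : Integrable fun ξ => (A₀ᵀ).map (algebraMap ℝ ℂ) *ᵥ adjSolDtFB A₀ A B₁ t₀ ψ t ξ +
      ∑ j, ((A j)ᵀ).map (algebraMap ℝ ℂ) *ᵥ gj j ξ := by
    exact hi1.add (integrable_finsetSum _ fun j _ => hi2 j)
  rw [← fourier_finset_sum_apply hi2, ← fourier_add_apply hi1
    (integrable_finsetSum _ fun j _ => hi2 j),
    ← fourier_sub_apply hi12 hi3]
  have hzero : (fun ξ => (A₀ᵀ).map (algebraMap ℝ ℂ) *ᵥ adjSolDtFB A₀ A B₁ t₀ ψ t ξ +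
      ∑ j, ((A j)ᵀ).map (algebraMap ℝ ℂ) *ᵥ gj j ξ - Bt *ᵥ g0 ξ) = fun _ => 0 := by
    funext ξ
    exact adjoint_eqn_fourierSideB hdet hψ hc t₀ t ξ
  rw [hzero]
  exact fourier_zero_apply (-x)

/-- **Bound for the adjoint solution**: `‖w(t, x)‖ ≤ kC e^{c₁|t-t₀|} ∫‖𝓕ψ‖`. [folklore] -/
theorem norm_adjSolB_le {C c₀ c₁ : ℝ} (hC : 0 ≤ C)
    (hT : ∀ τ : ℝ, HasExpTypeA (((τ : ℝ) : ℂ) • adjZeroth A₀ B₁) (adjPencil A₀ A τ)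
      (C * Real.exp (c₁ * |τ|)) (2 * Real.pi * c₀ * |τ|))
    {ψ : Space d → Fin k → ℂ} (hψ : ContDiff ℝ ∞ ψ) (hc : HasCompactSupport ψ) (t₀ t : ℝ)
    (x : Space d) :
    ‖adjSolB A₀ A B₁ t₀ ψ t x‖ ≤ k * (C * Real.exp (c₁ * |t - t₀|)) * ∫ ξ, ‖𝓕 ψ ξ‖ := by
  rw [adjSolB, multiplierOp_apply, Real.fourierInv_eq']
  refine (norm_integral_le_integral_norm _).trans ?_
  rw [← integral_const_mul]
  refine integral_mono_of_nonneg (Eventually.of_forall fun ξ => norm_nonneg _)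
    ((integrable_fourier_of_contDiff hψ hc).norm.const_mul _) (Eventually.of_forall fun ξ => ?_)
  dsimp only
  rw [norm_smul, Complex.norm_exp_ofReal_mul_I, one_mul]
  exact (Matrix.linfty_opNorm_mulVec _ _).trans
    (mul_le_mul_of_nonneg_right (norm_adjSymB_le hC hT t₀ t ξ) (norm_nonneg _))

/-- **Bound for the time derivative**:
`‖∂ₜw(t, x)‖ ≤ kC e^{c₁|t-t₀|} ∫ (‖E*‖ + K_G‖ξ‖) ‖𝓕ψ(ξ)‖`. [folklore] -/
theorem norm_adjSolDtB_le {C c₀ c₁ : ℝ} (hC : 0 ≤ C)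
    (hT : ∀ τ : ℝ, HasExpTypeA (((τ : ℝ) : ℂ) • adjZeroth A₀ B₁) (adjPencil A₀ A τ)
      (C * Real.exp (c₁ * |τ|)) (2 * Real.pi * c₀ * |τ|))
    {ψ : Space d → Fin k → ℂ} (hψ : ContDiff ℝ ∞ ψ) (hc : HasCompactSupport ψ) (t₀ t : ℝ)
    (x : Space d) :
    ‖adjSolDtB A₀ A B₁ t₀ ψ t x‖ ≤ ∫ ξ, (k * (C * Real.exp (c₁ * |t - t₀|))) *
      (‖adjZeroth A₀ B₁‖ * ‖𝓕 ψ ξ‖ + adjGenBound A₀ A * (‖ξ‖ * ‖𝓕 ψ ξ‖)) := by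
  rw [adjSolDtB, Real.fourierInv_eq']
  refine (norm_integral_le_integral_norm _).trans ?_
  refine integral_mono_of_nonneg (Eventually.of_forall fun ξ => norm_nonneg _)
    (integrable_dtMajorant (A₀ := A₀) (A := A) (B₁ := B₁) hψ hc _)
      (Eventually.of_forall fun ξ => ?_)
  dsimp only
  rw [norm_smul, Complex.norm_exp_ofReal_mul_I, one_mul]
  exact norm_adjSolDtFB_le hC hT t₀ ψ t ξ

end AdjointSolution

/-! ### The duality argument -/

section Duality

variable {A₀ : Matrix (Fin k) (Fin k) ℝ} {A : Fin d → Matrix (Fin k) (Fin k) ℝ}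
  {B₁ : (Fin k → ℝ) →L[ℝ] (Fin k → ℝ)}

/-- The support radius of the adjoint solution on `[0, 2t₀]`: `w(t, x) = 0` for
`‖x - x₁‖ > r + c₀t₀` and `|t - t₀| ≤ t₀`. [folklore] -/
theorem adjSolB_eq_zero_of_mem {C c₀ c₁ : ℝ} (hC : 0 ≤ C) (hc₀ : 0 ≤ c₀)
    (hT : ∀ τ : ℝ, HasExpTypeA (((τ : ℝ) : ℂ) • adjZeroth A₀ B₁) (adjPencil A₀ A τ)
      (C * Real.exp (c₁ * |τ|)) (2 * Real.pi * c₀ * |τ|))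
    {ψ : Space d → Fin k → ℂ} (hψ : ContDiff ℝ ∞ ψ) (hc : HasCompactSupport ψ) {x₁ : Space d}
    {r : ℝ} (hr : 0 ≤ r) (hsupp : tsupport ψ ⊆ closedBall x₁ r) {t₀ t : ℝ} (ht : |t - t₀| ≤ t₀)
    {x : Space d} (hx : r + c₀ * t₀ < ‖x - x₁‖) : adjSolB A₀ A B₁ t₀ ψ t x = 0 :=
  adjSolB_eq_zero hC hc₀ hT hψ hc hr hsupp t₀ t
    (lt_of_le_of_lt (by nlinarith) hx)

/-- Outside the support radius `r + c₀t₀` the time derivative vanishes too, for `t ∈ (0, 2t₀)`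
(the slice `w(·, x)` vanishes on that neighbourhood of `t`). [folklore] -/
theorem adjSolDtB_eq_zero_of_mem {C c₀ c₁ : ℝ} (hC : 0 ≤ C) (hc₀ : 0 ≤ c₀) (hc₁ : 0 ≤ c₁)
    (hT : ∀ τ : ℝ, HasExpTypeA (((τ : ℝ) : ℂ) • adjZeroth A₀ B₁) (adjPencil A₀ A τ)
      (C * Real.exp (c₁ * |τ|)) (2 * Real.pi * c₀ * |τ|))
    {ψ : Space d → Fin k → ℂ} (hψ : ContDiff ℝ ∞ ψ) (hc : HasCompactSupport ψ) {x₁ : Space d}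
    {r : ℝ} (hr : 0 ≤ r) (hsupp : tsupport ψ ⊆ closedBall x₁ r) {t₀ t : ℝ} (ht : t ∈ Ioo 0 (2 * t₀))
    {x : Space d} (hx : r + c₀ * t₀ < ‖x - x₁‖) : adjSolDtB A₀ A B₁ t₀ ψ t x = 0 := by
  -- `w(·, x)` vanishes on the neighbourhood `(0, 2t₀)` of `t`
  have hzero : ∀ s ∈ Ioo 0 (2 * t₀), adjSolB A₀ A B₁ t₀ ψ s x = 0 := fun s hs =>
    adjSolB_eq_zero_of_mem hC hc₀ hT hψ hc hr hsupp (abs_sub_le_iff.2 ⟨by linarith [hs.2], by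
      linarith [hs.1]⟩) hx
  have hev : (fun s => adjSolB A₀ A B₁ t₀ ψ s x) =ᶠ[𝓝 t] fun _ => 0 :=
    Filter.eventuallyEq_of_mem (Ioo_mem_nhds ht.1 ht.2) fun s hs => hzero s hs
  have h0 : HasDerivAt (fun s => adjSolB A₀ A B₁ t₀ ψ s x) 0 t :=
    (hasDerivAt_const t (0 : Fin k → ℂ)).congr_of_eventuallyEq hev
  exact (hasDerivAt_adjSolB hC hc₁ hT hψ hc t₀ x t).unique h0

/-- `x ↦ ∂ⱼw(t, x)` is continuous (a multiplier output). [folklore] -/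
theorem continuous_fderiv_adjSolB_apply {C c₀ c₁ : ℝ} (hC : 0 ≤ C)
    (hT : ∀ τ : ℝ, HasExpTypeA (((τ : ℝ) : ℂ) • adjZeroth A₀ B₁) (adjPencil A₀ A τ)
      (C * Real.exp (c₁ * |τ|)) (2 * Real.pi * c₀ * |τ|))
    {ψ : Space d → Fin k → ℂ} (hψ : ContDiff ℝ ∞ ψ) (hc : HasCompactSupport ψ) (t₀ t : ℝ)
    (v : Space d) : Continuous fun x => fderiv ℝ (adjSolB A₀ A B₁ t₀ ψ t) x v := by
  have hψv : ContDiff ℝ ∞ fun y => fderiv ℝ ψ y v :=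
    (hψ.fderiv_right (m := ∞) (by exact_mod_cast le_top)).clm_apply contDiff_const
  have hcv : HasCompactSupport fun y => fderiv ℝ ψ y v :=
    (hc.fderiv ℝ).comp_left (g := fun L : Space d →L[ℝ] (Fin k → ℂ) => L v) rfl
  have hfun : (fun x => fderiv ℝ (adjSolB A₀ A B₁ t₀ ψ t) x v) =
      multiplierOp (adjSymB A₀ A B₁ t₀ t) (fun y => fderiv ℝ ψ y v) :=
    funext fun x => fderiv_adjSolB_apply hC hT hψ hc t₀ t x v
  rw [hfun, multiplierOp_apply]
  exact continuous_fourierInv_of_integrable (integrable_mulVec_fourier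
    (measurable_adjSymB_apply t₀ t)
    (by positivity) (norm_adjSymB_apply_le hT t₀ t) (hcv.toSchwartzMap hψv))

/-- **Integration by parts in `x`** for the pairing of a `C¹` field `f` with the adjoint
solution (compactly supported in `x`): `∫ (Aⱼf)·∂ⱼw = -∫ (Aⱼ∂ⱼf)·w`. [folklore] -/
theorem integral_pair_fderiv_adjSolB {C c₀ c₁ : ℝ} (hC : 0 ≤ C)
    (hT : ∀ τ : ℝ, HasExpTypeA (((τ : ℝ) : ℂ) • adjZeroth A₀ B₁) (adjPencil A₀ A τ)
      (C * Real.exp (c₁ * |τ|)) (2 * Real.pi * c₀ * |τ|))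
    {ψ : Space d → Fin k → ℂ} (hψ : ContDiff ℝ ∞ ψ) (hc : HasCompactSupport ψ) (t₀ t : ℝ)
    (hw : HasCompactSupport (adjSolB A₀ A B₁ t₀ ψ t)) {f : Space d → Fin k → ℂ}
      (hf : ContDiff ℝ 1 f)
    (M : Matrix (Fin k) (Fin k) ℂ) (j : Fin d) :
    ∫ x, (M *ᵥ f x) ⬝ᵥ fderiv ℝ (adjSolB A₀ A B₁ t₀ ψ t) x (EuclideanSpace.single j 1) =
      -∫ x, (M *ᵥ fderiv ℝ f x (EuclideanSpace.single j 1)) ⬝ᵥ adjSolB A₀ A B₁ t₀ ψ t x := by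
  set w := adjSolB A₀ A B₁ t₀ ψ t with hwdef
  set e : Space d := EuclideanSpace.single j 1 with he
  have hfd : Differentiable ℝ f := hf.differentiable one_ne_zero
  have hfc : Continuous f := hf.continuous
  have hf'c : Continuous fun x => fderiv ℝ f x e :=
    (hf.continuous_fderiv one_ne_zero).clm_apply continuous_const
  have hwc : Continuous w := (differentiable_adjSolB hC hT hψ hc t₀ t).continuous
  have hw'c : Continuous fun x => fderiv ℝ w x e :=
    continuous_fderiv_adjSolB_apply hC hT hψ hc t₀ t e
  have hw' : HasCompactSupport fun x => fderiv ℝ w x e :=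
    (hw.fderiv ℝ).comp_left (g := fun L : Space d →L[ℝ] (Fin k → ℂ) => L e) rfl
  have hMc : ∀ {g : Space d → Fin k → ℂ}, Continuous g → Continuous fun x => M *ᵥ g x :=
    fun hg => (mulVecBilin M).continuous.comp hg
  have h := integral_bilinear_hasLineDerivAt_right_eq_neg_left_of_integrable
    (μ := (volume : Measure (Space d))) (f := fun x => M *ᵥ f x)
    (f' := fun x => M *ᵥ fderiv ℝ f x e) (g := w) (g' := fun x => fderiv ℝ w x e) (v := e)
    (B := dotBilin k) ?_ ?_ ?_ ?_ ?_
  · simpa using h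
  · -- `B(f', g)` integrable: continuous with compact support
    exact ((dotBilin k).continuous₂.comp ((hMc hf'c).prodMk hwc)).integrable_of_hasCompactSupport
      (hw.mono fun x hx => by
        rw [Function.mem_support] at hx ⊢; contrapose! hx; simp [hx])
  · exact ((dotBilin k).continuous₂.comp ((hMc hfc).prodMk hw'c)).integrable_of_hasCompactSupport
      (hw'.mono fun x hx => by
        rw [Function.mem_support] at hx ⊢; contrapose! hx; simp [hx])
  · exact ((dotBilin k).continuous₂.comp ((hMc hfc).prodMk hwc)).integrable_of_hasCompactSupport
      (hw.mono fun x hx => by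
        rw [Function.mem_support] at hx ⊢; contrapose! hx; simp [hx])
  · intro x _
    have h1 : HasFDerivAt (fun x => M *ᵥ f x) ((mulVecBilin M).comp (fderiv ℝ f x)) x :=
      (mulVecBilin M).hasFDerivAt.comp x (hfd x).hasFDerivAt
    exact h1.hasLineDerivAt e
  · intro x _
    exact ((differentiable_adjSolB hC hT hψ hc t₀ t) x).hasFDerivAt.hasLineDerivAt e

/-! ### The pairing `P(t) = ∫ (A₀u)·w` and its constancy -/

variable {T : ℝ} {u : ℝ → Space d → Fin k → ℝ}

/-- The complexified pairing integrand `(A₀)_ℂ u_ℂ(t, x) · w(t, x)`. [folklore] -/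
def pairFB (A₀ : Matrix (Fin k) (Fin k) ℝ) (A : Fin d → Matrix (Fin k) (Fin k) ℝ)
    (B₁ : (Fin k → ℝ) →L[ℝ] (Fin k → ℝ)) (u : ℝ → Space d → Fin k → ℝ) (t₀ : ℝ)
    (ψ : Space d → Fin k → ℂ) (t : ℝ) (x : Space d) : ℂ :=
  (A₀.map (algebraMap ℝ ℂ) *ᵥ cplx (u t) x) ⬝ᵥ adjSolB A₀ A B₁ t₀ ψ t x

/-- Its time derivative `(A₀)_ℂ ∂ₜu_ℂ · w + (A₀)_ℂ u_ℂ · ∂ₜw`. [folklore] -/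
def pairFB' (A₀ : Matrix (Fin k) (Fin k) ℝ) (A : Fin d → Matrix (Fin k) (Fin k) ℝ)
    (B₁ : (Fin k → ℝ) →L[ℝ] (Fin k → ℝ)) (u : ℝ → Space d → Fin k → ℝ) (t₀ : ℝ)
    (ψ : Space d → Fin k → ℂ) (t : ℝ) (x : Space d) : ℂ :=
  (A₀.map (algebraMap ℝ ℂ) *ᵥ Literature.Analysis.Fourier.timeDeriv (fun s => cplx (u s)) t x) ⬝ᵥ
      adjSolB A₀ A B₁ t₀ ψ t x +
    (A₀.map (algebraMap ℝ ℂ) *ᵥ cplx (u t) x) ⬝ᵥ adjSolDtB A₀ A B₁ t₀ ψ t x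

/-- **The pointwise identity behind `P' = 0`**: at interior times, by the equation for `u` and the
adjoint equation for `w`, `(A₀∂ₜu)·w + (A₀u)·∂ₜw = -Σⱼ [(Aⱼ∂ⱼu)·w + (Aⱼu)·∂ⱼw]` — the zeroth-order
terms `-(B₁u)·w + u·(B₁ᵀw)` cancelling pointwise. [cite: Rauch1986, Proof of Theorem p. 483] -/
theorem pairFB'_eq (hu : (ofConstant A₀ A B₁).IsClassicalSolution T u) (hdet : A₀.det ≠ 0)
    {C c₀ c₁ : ℝ} (hC : 0 ≤ C) (hT : ∀ τ : ℝ, HasExpTypeA (((τ : ℝ) : ℂ) • adjZeroth A₀ B₁)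
      (adjPencil A₀ A τ)
      (C * Real.exp (c₁ * |τ|)) (2 * Real.pi * c₀ * |τ|))
    {ψ : Space d → Fin k → ℂ} (hψ : ContDiff ℝ ∞ ψ) (hc : HasCompactSupport ψ) (t₀ : ℝ) {t : ℝ}
    (ht : t ∈ Ioo 0 T) (x : Space d) :
    pairFB' A₀ A B₁ u t₀ ψ t x =
      -∑ j, (((A j).map (algebraMap ℝ ℂ) *ᵥ fderiv ℝ (cplx (u t)) x (EuclideanSpace.single j 1)) ⬝ᵥ
          adjSolB A₀ A B₁ t₀ ψ t x +
        ((A j).map (algebraMap ℝ ℂ) *ᵥ cplx (u t) x) ⬝ᵥ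
          fderiv ℝ (adjSolB A₀ A B₁ t₀ ψ t) x (EuclideanSpace.single j 1)) := by
  set Bm : Matrix (Fin k) (Fin k) ℂ :=
    (LinearMap.toMatrix' (B₁ : (Fin k → ℝ) →ₗ[ℝ] (Fin k → ℝ))).map (algebraMap ℝ ℂ) with hBm
  -- the equation for `u`, complexified (with the zeroth-order term `B₁`)
  have hu' := eqn_cplx hu ht x
  have h1 : A₀.map (algebraMap ℝ ℂ) *ᵥ Literature.Analysis.Fourier.timeDeriv (fun s => cplx
    (u s)) t x =
      -(∑ j, (A j).map (algebraMap ℝ ℂ) *ᵥ fderiv ℝ (cplx (u t)) x (EuclideanSpace.single j 1) +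
        Bm *ᵥ cplx (u t) x) := by
    rw [add_assoc] at hu'
    exact eq_neg_of_add_eq_zero_left hu'
  -- the adjoint equation for `w` (zeroth-order term `-B₁ᵀ`)
  have h2 : (A₀ᵀ).map (algebraMap ℝ ℂ) *ᵥ adjSolDtB A₀ A B₁ t₀ ψ t x =
      -∑ j, ((A j)ᵀ).map (algebraMap ℝ ℂ) *ᵥ
        fderiv ℝ (adjSolB A₀ A B₁ t₀ ψ t) x
          (EuclideanSpace.single j 1) + Bmᵀ *ᵥ adjSolB A₀ A B₁ t₀ ψ t x := by
    have h := adjoint_eqnB hdet hC hT hψ hc t₀ t x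
    rw [hBm, ← transpose_map]
    rw [sub_eq_zero, add_comm] at h
    exact eq_neg_add_of_add_eq h
  rw [pairFB', h1, mulVec_dotProduct_eq (A₀.map (algebraMap ℝ ℂ)), ← transpose_map, h2,
    neg_dotProduct, add_dotProduct, dotProduct_add, dotProduct_neg, sum_dotProduct, dotProduct_sum,
    ← mulVec_dotProduct_eq Bm]
  -- the zeroth-order terms cancel
  have hcancel : ∀ (S S' b : ℂ), -(S + b) + (-S' + b) = -(S + S') := fun S S' b => by ring
  rw [hcancel, ← Finset.sum_add_distrib]
  congr 1
  refine Finset.sum_congr rfl fun j _ => ?_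
  rw [transpose_map, ← mulVec_dotProduct_eq]

/-- **`∫ P'(t) = 0` integrand-wise**: at interior times, if `w(t)` is compactly supported,
`∫ [(A₀∂ₜu)·w + (A₀u)·∂ₜw] dx = 0` (integrate the identity `pairFB'_eq` by parts in `x`).
[cite: Rauch1986, Proof of Theorem p. 483] -/
theorem integral_pairFB'_eq_zero (hu : (ofConstant A₀ A B₁).IsClassicalSolution T u)
    (hdet : A₀.det ≠ 0) {C c₀ c₁ : ℝ} (hC : 0 ≤ C)
    (hT : ∀ τ : ℝ, HasExpTypeA (((τ : ℝ) : ℂ) • adjZeroth A₀ B₁) (adjPencil A₀ A τ)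
      (C * Real.exp (c₁ * |τ|)) (2 * Real.pi * c₀ * |τ|))
    {ψ : Space d → Fin k → ℂ} (hψ : ContDiff ℝ ∞ ψ) (hc : HasCompactSupport ψ) (t₀ : ℝ) {t : ℝ}
    (ht : t ∈ Ioo 0 T) (hw : HasCompactSupport (adjSolB A₀ A B₁ t₀ ψ t)) :
    ∫ x, pairFB' A₀ A B₁ u t₀ ψ t x = 0 := by
  have huc : ContDiff ℝ 1 (cplx (u t)) := contDiff_cplx_slice hu (Ioo_subset_Icc_self ht)
  set w := adjSolB A₀ A B₁ t₀ ψ t with hwdef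
  set e : Fin d → Space d := fun j => EuclideanSpace.single j 1 with he
  -- the two families of integrands
  set f1 : Fin d → Space d → ℂ := fun j x =>
    ((A j).map (algebraMap ℝ ℂ) *ᵥ fderiv ℝ (cplx (u t)) x (e j)) ⬝ᵥ w x with hf1
  set f2 : Fin d → Space d → ℂ := fun j x =>
    ((A j).map (algebraMap ℝ ℂ) *ᵥ cplx (u t) x) ⬝ᵥ fderiv ℝ w x (e j) with hf2
  have hIBP : ∀ j, ∫ x, f2 j x = -∫ x, f1 j x := fun j =>
    integral_pair_fderiv_adjSolB hC hT hψ hc t₀ t hw huc _ j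
  -- integrability (continuous with compact support)
  have hwc : Continuous w := (differentiable_adjSolB hC hT hψ hc t₀ t).continuous
  have hw'c : ∀ j, Continuous fun x => fderiv ℝ w x (e j) := fun j =>
    continuous_fderiv_adjSolB_apply hC hT hψ hc t₀ t (e j)
  have hw' : ∀ j, HasCompactSupport fun x => fderiv ℝ w x (e j) := fun j =>
    (hw.fderiv ℝ).comp_left (g := fun L : Space d →L[ℝ] (Fin k → ℂ) => L (e j)) rfl
  have hMc : ∀ (M : Matrix (Fin k) (Fin k) ℂ) {g : Space d → Fin k → ℂ}, Continuous g →
      Continuous fun x => M *ᵥ g x := fun M _ hg => (mulVecBilin M).continuous.comp hg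
  have hi1 : ∀ j, Integrable (f1 j) := fun j =>
    ((dotBilin k).continuous₂.comp ((hMc _ ((huc.continuous_fderiv one_ne_zero).clm_apply
      continuous_const)).prodMk hwc)).integrable_of_hasCompactSupport
      (hw.mono fun x hx => by
        rw [Function.mem_support] at hx ⊢; contrapose! hx; simp [hx])
  have hi2 : ∀ j, Integrable (f2 j) := fun j =>
    ((dotBilin k).continuous₂.comp ((hMc _ huc.continuous).prodMk
      (hw'c j))).integrable_of_hasCompactSupport
      ((hw' j).mono fun x hx => by
        rw [Function.mem_support] at hx ⊢; contrapose! hx; simp [hx])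
  have hfun : (fun x => pairFB' A₀ A B₁ u t₀ ψ t x) = fun x => -∑ j, (f1 j x + f2 j x) := by
    funext x
    exact pairFB'_eq hu hdet hC hT hψ hc t₀ ht x
  have hsum : ∫ a, ∑ j, (f1 j a + f2 j a) = ∑ j, ∫ a, (f1 j a + f2 j a) :=
    integral_finsetSum _ fun j _ => (hi1 j).add (hi2 j)
  rw [hfun, integral_neg, hsum, neg_eq_zero]
  refine Finset.sum_eq_zero fun j _ => ?_
  rw [integral_add (hi1 j) (hi2 j), hIBP j, add_neg_cancel]
set_option maxHeartbeats 400000 in -- buildfix (bf3-g26): 160k/180k FAIL, 200k PASS at accept time; line-neutral budget line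
/-- **The duality identity `P(t₀) = P(0)`.** For a classical solution `u` of the
constant-coefficient
system on `[0, T]`, `0 < t₀ ≤ T`, and `ψ ∈ C_c^∞` supported in `B̄(x₁, r)`:
`∫ (A₀u(t₀))·w(t₀) dx = ∫ (A₀u(0))·w(0) dx`, `w` the adjoint solution with `w(t₀) = ψ`
(`P` is continuous on `[0, t₀]` and `P' = 0` on `(0, t₀)`: differentiation under the integral
sign, dominated on the compact support of `w`, and `integral_pairFB'_eq_zero`).
[cite: Rauch1986, Proof of Theorem p. 483] -/
theorem integral_pairFB_eq (hu : (ofConstant A₀ A B₁).IsClassicalSolution T u) (hdet : A₀.det ≠ 0)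
    {C c₀ c₁ : ℝ} (hC : 0 ≤ C) (hc₀ : 0 ≤ c₀) (hc₁ : 0 ≤ c₁)
    (hT : ∀ τ : ℝ, HasExpTypeA (((τ : ℝ) : ℂ) • adjZeroth A₀ B₁) (adjPencil A₀ A τ)
      (C * Real.exp (c₁ * |τ|)) (2 * Real.pi * c₀ * |τ|))
    {ψ : Space d → Fin k → ℂ} (hψ : ContDiff ℝ ∞ ψ) (hc : HasCompactSupport ψ) {x₁ : Space d}
    {r : ℝ} (hr : 0 ≤ r) (hsupp : tsupport ψ ⊆ closedBall x₁ r) {t₀ : ℝ} (ht₀ : 0 < t₀)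
    (ht₀T : t₀ ≤ T) :
    ∫ x, pairFB A₀ A B₁ u t₀ ψ t₀ x = ∫ x, pairFB A₀ A B₁ u t₀ ψ 0 x := by
  -- notation
  set uc : ℝ → Space d → Fin k → ℂ := fun s => cplx (u s) with huc
  set Mℂ : Matrix (Fin k) (Fin k) ℂ := A₀.map (algebraMap ℝ ℂ) with hMℂ
  set K : Set (Space d) := closedBall x₁ (r + c₀ * t₀) with hK
  have hKc : IsCompact K := isCompact_closedBall _ _
  set P : ℝ → ℂ := fun t => ∫ x, pairFB A₀ A B₁ u t₀ ψ t x with hP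
  -- regularity of `u_ℂ` on the slab
  have hdiff : ContDiffOn ℝ 1 (Function.uncurry uc) (Icc 0 T ×ˢ univ) := contDiffOn_uncurry_cplx hu
  have hcontT : ContinuousOn (Function.uncurry uc) (Icc 0 T ×ˢ univ) := hdiff.continuousOn
  have hslice : ∀ t ∈ Icc 0 T, Continuous (uc t) := fun t ht =>
    (contDiff_cplx_slice hu ht).continuous
  -- support of `w(t)` for `|t - t₀| ≤ t₀`
  have hwK : ∀ t, |t - t₀| ≤ t₀ → ∀ x, x ∉ K → adjSolB A₀ A B₁ t₀ ψ t x = 0 := fun t ht x hx =>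
    adjSolB_eq_zero_of_mem hC hc₀ hT hψ hc hr hsupp ht (by
      rwa [hK, mem_closedBall, dist_eq_norm, not_le] at hx)
  have hwcs : ∀ t, |t - t₀| ≤ t₀ → HasCompactSupport (adjSolB A₀ A B₁ t₀ ψ t) := fun t ht =>
    HasCompactSupport.intro hKc (hwK t ht)
  have hwc : ∀ t, Continuous (adjSolB A₀ A B₁ t₀ ψ t) := fun t =>
    (differentiable_adjSolB hC hT hψ hc t₀ t).continuous
  -- uniform bounds for `w` and `∂ₜw` on `|t - t₀| ≤ t₀`
  set Ct : ℝ := C * Real.exp (c₁ * t₀) with hCt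
  have hCt' : ∀ t, |t - t₀| ≤ t₀ → C * Real.exp (c₁ * |t - t₀|) ≤ Ct := fun t ht =>
    timeConst_le hC hc₁ ht
  set Bw : ℝ := k * Ct * ∫ ξ, ‖𝓕 ψ ξ‖ with hBw
  set Bdt : ℝ := ∫ ξ, (k * Ct) *
    (‖adjZeroth A₀ B₁‖ * ‖𝓕 ψ ξ‖ + adjGenBound A₀ A * (‖ξ‖ * ‖𝓕 ψ ξ‖)) with hBdt
  have hmaj0 : ∀ ξ : Space d, 0 ≤ ‖adjZeroth A₀ B₁‖ * ‖𝓕 ψ ξ‖ + adjGenBound A₀ A *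
    (‖ξ‖ * ‖𝓕 ψ ξ‖) :=
    fun ξ => add_nonneg (mul_nonneg (norm_nonneg _) (norm_nonneg _))
      (mul_nonneg (adjGenBound_nonneg A₀ A) (mul_nonneg (norm_nonneg _) (norm_nonneg _)))
  have hBw' : ∀ t, |t - t₀| ≤ t₀ → ∀ x, ‖adjSolB A₀ A B₁ t₀ ψ t x‖ ≤ Bw := fun t ht x =>
    (norm_adjSolB_le hC hT hψ hc t₀ t x).trans (mul_le_mul_of_nonneg_right
      (mul_le_mul_of_nonneg_left (hCt' t ht) (Nat.cast_nonneg k))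
      (integral_nonneg fun _ => norm_nonneg _))
  have hBdt' : ∀ t, |t - t₀| ≤ t₀ → ∀ x, ‖adjSolDtB A₀ A B₁ t₀ ψ t x‖ ≤ Bdt := fun t ht x =>
    (norm_adjSolDtB_le hC hT hψ hc t₀ t x).trans (integral_mono (integrable_dtMajorant (A₀ := A₀)
      (A := A) (B₁ := B₁) hψ hc _)
      (integrable_dtMajorant (A₀ := A₀) (A := A)
        (B₁ := B₁) hψ hc _) fun ξ => mul_le_mul_of_nonneg_right
        (mul_le_mul_of_nonneg_left (hCt' t ht) (Nat.cast_nonneg k)) (hmaj0 ξ))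
  -- the integrand is continuous in `x` and compactly supported
  have hFc : ∀ t ∈ Icc 0 T, Continuous (pairFB A₀ A B₁ u t₀ ψ t) := fun t ht =>
    (dotBilin k).continuous₂.comp (((mulVecBilin Mℂ).continuous.comp (hslice t ht)).prodMk (hwc t))
  -- (1) continuity of `P` on `[0, t₀]`
  obtain ⟨Bu, hBu⟩ := (isCompact_Icc.prod hKc).exists_bound_of_continuousOn
    (f := Function.uncurry uc) (hcontT.mono (prod_mono (Icc_subset_Icc_right ht₀T) (subset_univ _)))
  have hPcont : ContinuousOn P (Icc 0 t₀) := by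
    refine continuousOn_of_dominated (bound := K.indicator fun _ => k * (‖Mℂ‖ * Bu) * Bw)
      (fun t ht => (hFc t (Icc_subset_Icc_right ht₀T ht)).aestronglyMeasurable)
      (fun t ht => Eventually.of_forall fun x => ?_) ?_ (Eventually.of_forall fun x => ?_)
    · -- the bound
      by_cases hx : x ∈ K
      · rw [indicator_of_mem hx, pairFB]
        refine (norm_dotProduct_le' _ _).trans ?_
        have h1 : ‖Mℂ *ᵥ cplx (u t) x‖ ≤ ‖Mℂ‖ * Bu :=
          (Matrix.linfty_opNorm_mulVec _ _).trans
            (mul_le_mul_of_nonneg_left (hBu (t, x) ⟨ht, hx⟩) (norm_nonneg _))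
        have h0 : 0 ≤ ‖Mℂ‖ * Bu := le_trans (by positivity) h1
        exact mul_le_mul (mul_le_mul_of_nonneg_left h1 (Nat.cast_nonneg k))
          (hBw' t (abs_sub_le_iff.2 ⟨by linarith [ht.2], by linarith [ht.1]⟩) x)
          (norm_nonneg _) (by positivity)
      · rw [indicator_of_notMem hx, pairFB, hwK t (abs_sub_le_iff.2 ⟨by linarith [ht.2], by
          linarith [ht.1]⟩) x hx, dotProduct_zero, norm_zero]
    · exact (integrableOn_const (hKc.measure_lt_top).ne).integrable_indicator hKc.measurableSet
    · -- continuity in `t` for fixed `x`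
      have h1 : ContinuousOn (fun t => uc t x) (Icc 0 t₀) :=
        (hcontT.comp (continuous_id.prodMk continuous_const).continuousOn fun t ht =>
          ⟨Icc_subset_Icc_right ht₀T ht, mem_univ x⟩)
      have h2 : Continuous fun t => adjSolB A₀ A B₁ t₀ ψ t x :=
        continuous_iff_continuousAt.2 fun t =>
        (hasDerivAt_adjSolB hC hc₁ hT hψ hc t₀ x t).continuousAt
      exact (dotBilin k).continuous₂.comp_continuousOn
        ((((mulVecBilin Mℂ).continuous.comp_continuousOn h1)).prodMk h2.continuousOn)
  -- (2) `P' = 0` on `(0, t₀)`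
  have hPderiv : ∀ t₁ ∈ Ioo 0 t₀, HasDerivAt P 0 t₁ := by
    intro t₁ ht₁
    set a : ℝ := t₁ / 2 with ha
    set b : ℝ := (t₁ + t₀) / 2 with hb
    have ha0 : 0 < a := by rw [ha]; linarith [ht₁.1]
    have hab : a < t₁ ∧ t₁ < b := ⟨by rw [ha]; linarith [ht₁.1], by rw [hb]; linarith [ht₁.2]⟩
    have hbT : b < T := by rw [hb]; linarith [ht₁.2]
    have hbt₀ : b < t₀ := by rw [hb]; linarith [ht₁.2]
    have hsub : Icc a b ⊆ Ioo 0 T := fun t ht => ⟨ha0.trans_le ht.1, ht.2.trans_lt hbT⟩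
    -- bounds for `u_ℂ` and `∂ₜu_ℂ` on `[a, b] × K`
    obtain ⟨Bu₁, hBu₁⟩ := (isCompact_Icc.prod hKc).exists_bound_of_continuousOn
      (f := Function.uncurry uc)
      (hcontT.mono (prod_mono (fun t ht => Ioo_subset_Icc_self (hsub ht)) (subset_univ _)))
    have ho : IsOpen (Ioo 0 T ×ˢ (univ : Set (Space d))) := isOpen_Ioo.prod isOpen_univ
    have hcD : ContinuousOn (fderiv ℝ (Function.uncurry uc)) (Ioo 0 T ×ˢ univ) :=
      (hdiff.mono (prod_mono Ioo_subset_Icc_self subset_rfl)).continuousOn_fderiv_of_isOpen ho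
        le_rfl
    have hcDt : ContinuousOn
      (fun p : ℝ × Space d => Literature.Analysis.Fourier.timeDeriv uc p.1 p.2)
        (Ioo 0 T ×ˢ univ) :=
      (ContinuousLinearMap.apply ℝ (Fin k → ℂ) ((1 : ℝ),
        (0 : Space d))).continuous.comp_continuousOn hcD
    obtain ⟨Bu₂, hBu₂⟩ := (isCompact_Icc.prod hKc).exists_bound_of_continuousOn
      (hcDt.mono (prod_mono hsub (subset_univ _)))
    set F' : ℝ → Space d → ℂ := fun t x => pairFB' A₀ A B₁ u t₀ ψ t x with hF'
    have key := hasDerivAt_integral_of_dominated_loc_of_deriv_le (μ := (volume : Measure (Space d)))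
      (F := fun t x => pairFB A₀ A B₁ u t₀ ψ t x) (F' := F') (x₀ := t₁) (s := Ioo a b)
      (bound := K.indicator fun _ => k * (‖Mℂ‖ * Bu₂) * Bw + k * (‖Mℂ‖ * Bu₁) * Bdt)
      (Ioo_mem_nhds hab.1 hab.2) ?_ ?_ ?_ ?_ ?_ ?_
    · have hint : ∫ x, F' t₁ x = 0 :=
        integral_pairFB'_eq_zero hu hdet hC hT hψ hc t₀ ⟨ht₁.1, ht₁.2.trans_le ht₀T⟩
          (hwcs t₁ (abs_sub_le_iff.2 ⟨by linarith [ht₁.2], by linarith [ht₁.1]⟩))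
      have h := key.2
      rwa [hint] at h
    · exact Filter.eventually_of_mem (Ioo_mem_nhds hab.1 hab.2) fun t ht =>
        (hFc t (Ioo_subset_Icc_self (hsub (Ioo_subset_Icc_self ht)))).aestronglyMeasurable
    · -- integrability of `F t₁`
      exact (hFc t₁ ⟨ht₁.1.le, ht₁.2.le.trans ht₀T⟩).integrable_of_hasCompactSupport
        ((hwcs t₁ (abs_sub_le_iff.2 ⟨by linarith [ht₁.2], by linarith [ht₁.1]⟩)).mono fun x hx => by
          rw [Function.mem_support] at hx ⊢; contrapose! hx; simp [pairFB, hx])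
    · -- measurability of `F' t₁`
      have h1 : Continuous fun x => Literature.Analysis.Fourier.timeDeriv uc t₁ x :=
        (hcDt.comp_continuous (continuous_const.prodMk continuous_id) fun x =>
          ⟨⟨ht₁.1, ht₁.2.trans_le ht₀T⟩, mem_univ x⟩ :)
      have h2 := hslice t₁ ⟨ht₁.1.le, ht₁.2.le.trans ht₀T⟩
      have h3 := continuous_adjSolDtB hC hT hψ hc t₀ t₁ (A₀ := A₀) (A := A)
      refine Continuous.aestronglyMeasurable ?_
      show Continuous fun x => pairFB' A₀ A B₁ u t₀ ψ t₁ x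
      unfold pairFB'
      exact ((dotBilin k).continuous₂.comp (((mulVecBilin Mℂ).continuous.comp h1).prodMk
        (hwc t₁))).add
        ((dotBilin k).continuous₂.comp (((mulVecBilin Mℂ).continuous.comp h2).prodMk h3))
    · -- domination on `(a, b)`
      refine Eventually.of_forall fun x t ht => ?_
      have ht' : |t - t₀| ≤ t₀ := abs_sub_le_iff.2 ⟨by linarith [ht.2], by linarith [ht.1]⟩
      by_cases hx : x ∈ K
      · rw [indicator_of_mem hx, hF']
        simp only [pairFB']
        refine (norm_add_le _ _).trans (add_le_add ?_ ?_)
        · refine (norm_dotProduct_le' _ _).trans ?_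
          have h1 : ‖Mℂ *ᵥ Literature.Analysis.Fourier.timeDeriv uc t x‖ ≤ ‖Mℂ‖ * Bu₂ :=
            (Matrix.linfty_opNorm_mulVec _ _).trans
              (mul_le_mul_of_nonneg_left (hBu₂ (t, x) ⟨Ioo_subset_Icc_self ht, hx⟩) (norm_nonneg _))
          have h0 : 0 ≤ ‖Mℂ‖ * Bu₂ := le_trans (by positivity) h1
          exact mul_le_mul (mul_le_mul_of_nonneg_left h1 (Nat.cast_nonneg k)) (hBw' t ht' x)
            (norm_nonneg _) (by positivity)
        · refine (norm_dotProduct_le' _ _).trans ?_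
          have h1 : ‖Mℂ *ᵥ cplx (u t) x‖ ≤ ‖Mℂ‖ * Bu₁ :=
            (Matrix.linfty_opNorm_mulVec _ _).trans
              (mul_le_mul_of_nonneg_left (hBu₁ (t, x) ⟨Ioo_subset_Icc_self ht, hx⟩) (norm_nonneg _))
          have h0 : 0 ≤ ‖Mℂ‖ * Bu₁ := le_trans (by positivity) h1
          exact mul_le_mul (mul_le_mul_of_nonneg_left h1 (Nat.cast_nonneg k)) (hBdt' t ht' x)
            (norm_nonneg _) (by positivity)
      · rw [indicator_of_notMem hx, hF']
        simp only [pairFB']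
        rw [hwK t ht' x hx, adjSolDtB_eq_zero_of_mem hC hc₀ hc₁ hT hψ hc hr hsupp
          ⟨ha0.trans ht.1, by linarith [ht.2]⟩
            (by rwa [hK, mem_closedBall, dist_eq_norm, not_le] at hx),
          dotProduct_zero, dotProduct_zero, add_zero, norm_zero]
    · exact (integrableOn_const (hKc.measure_lt_top).ne).integrable_indicator hKc.measurableSet
    · -- pointwise derivative in `t`
      refine Eventually.of_forall fun x t ht => ?_
      have htT : t ∈ Ioo 0 T := hsub (Ioo_subset_Icc_self ht)
      have hU : HasDerivAt (fun s => Mℂ *ᵥ uc s x)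
          (Mℂ *ᵥ Literature.Analysis.Fourier.timeDeriv uc t x) t :=
        (mulVecBilin Mℂ).hasFDerivAt.comp_hasDerivAt t
          (Literature.Analysis.Fourier.hasDerivAt_slice hdiff htT x)
      have hW := hasDerivAt_adjSolB hC hc₁ hT hψ hc t₀ x t (A₀ := A₀) (A := A) (B₁ := B₁)
      have h := (dotBilin k).hasDerivAt_of_bilinear (fun _ => hU) (fun _ => hW)
      refine h.congr_deriv ?_
      simp only [dotBilin_apply, hF', pairFB']
      exact add_comm _ _
  -- (3) constancy on `(0, t₀)` and passage to the endpoints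
  have hconst : ∀ s₁ ∈ Ioo 0 t₀, ∀ s₂ ∈ Ioo 0 t₀, P s₁ = P s₂ := fun s₁ hs₁ s₂ hs₂ =>
    isOpen_Ioo.is_const_of_deriv_eq_zero isPreconnected_Ioo
      (fun t ht => (hPderiv t ht).differentiableAt.differentiableWithinAt)
      (fun t ht => by rw [Pi.zero_apply]; exact (hPderiv t ht).deriv) hs₁ hs₂
  have hmid : t₀ / 2 ∈ Ioo 0 t₀ := ⟨by linarith, by linarith⟩
  have hcl : Icc 0 t₀ ⊆ closure (Ioo 0 t₀) := by
    rw [closure_Ioo ht₀.ne]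
  have hEq : EqOn P (fun _ => P (t₀ / 2)) (Icc 0 t₀) :=
    Set.EqOn.of_subset_closure (fun t ht => hconst t ht _ hmid) hPcont continuousOn_const
      Ioo_subset_Icc_self hcl
  have h0 : P 0 = P (t₀ / 2) := hEq ⟨le_rfl, ht₀.le⟩
  have h1 : P t₀ = P (t₀ / 2) := hEq ⟨ht₀.le, le_rfl⟩
  show P t₀ = P 0
  rw [h1, h0]

/-- **The duality identity with its endpoints evaluated**: if moreover the datum `u(0)` vanishes
for `‖x‖ > R` and `2r ≤ ‖x₁‖ - R - c₀t₀`, then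
`∫ (A₀u(t₀, x))_ℂ · ψ(x) dx = 0` (`w(t₀) = ψ`, and at time `0` the supports of `u(0)` and `w(0)`
are disjoint). [cite: Rauch1986, Proof of Theorem p. 483] -/
theorem integral_mulVec_dotProduct_eq_zero_zeroth
    (hu : (ofConstant A₀ A B₁).IsClassicalSolution T u)
    (hdet : A₀.det ≠ 0) {C c₀ c₁ : ℝ} (hC : 0 ≤ C) (hc₀ : 0 ≤ c₀) (hc₁ : 0 ≤ c₁)
    (hT : ∀ τ : ℝ, HasExpTypeA (((τ : ℝ) : ℂ) • adjZeroth A₀ B₁) (adjPencil A₀ A τ)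
      (C * Real.exp (c₁ * |τ|)) (2 * Real.pi * c₀ * |τ|))
    {R : ℝ} (h0 : ∀ x : Space d, R < ‖x‖ → u 0 x = 0) {t₀ : ℝ} (ht₀ : 0 < t₀) (ht₀T : t₀ ≤ T)
    {x₁ : Space d} {r : ℝ} (hr : 0 < r) (hx₁ : 2 * r ≤ ‖x₁‖ - R - c₀ * t₀)
    {ψ : Space d → Fin k → ℂ} (hψ : ContDiff ℝ ∞ ψ) (hc : HasCompactSupport ψ)
    (hsupp : tsupport ψ ⊆ closedBall x₁ r) :
    ∫ x, (A₀.map (algebraMap ℝ ℂ) *ᵥ cplx (u t₀) x) ⬝ᵥ ψ x = 0 := by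
  have h := integral_pairFB_eq hu hdet hC hc₀ hc₁ hT hψ hc hr.le hsupp ht₀ ht₀T
  have hL : (fun x => pairFB A₀ A B₁ u t₀ ψ t₀ x) =
      fun x => (A₀.map (algebraMap ℝ ℂ) *ᵥ cplx (u t₀) x) ⬝ᵥ ψ x := by
    funext x; rw [pairFB, adjSolB_self hψ hc]
  have hR : (fun x => pairFB A₀ A B₁ u t₀ ψ 0 x) = fun _ => 0 := by
    funext x
    rw [pairFB]
    rcases lt_or_ge R ‖x‖ with hx | hx
    · rw [cplx_apply, h0 x hx, map_zero, mulVec_zero, zero_dotProduct]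
    · have hfar : r + c₀ * |0 - t₀| < ‖x - x₁‖ := by
        rw [zero_sub, abs_neg, abs_of_pos ht₀]
        have h1 : ‖x₁‖ - ‖x‖ ≤ ‖x - x₁‖ := by
          rw [← norm_neg (x - x₁), neg_sub]; exact norm_sub_norm_le x₁ x
        linarith
      rw [adjSolB_eq_zero hC hc₀ hT hψ hc hr.le hsupp t₀ 0 hfar, dotProduct_zero]
  rw [hL, hR, integral_zero] at h
  exact h

/-- **Finite speed of propagation for constant-coefficient systems in Rauch's class at `0`, WITH
zeroth-order term** (both branches: symmetrizable, or `A₀` invertible and strictly hyperbolic; `B₁`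
arbitrary): there is `c ≥ 0` such that every classical solution `u` of `A₀∂ₜu + Σ Aⱼ∂ⱼu + B₁u = 0`
on `[0, T] × ℝᵈ` with `u(0, x) = 0` for `‖x‖ > R` satisfies `u(t, x) = 0` for `‖x‖ > R + ct`,
`0 ≤ t ≤ T`. Proof: Holmgren–John duality with the adjoint solutions `adjSolB` of
`A₀ᵀ∂ₜw + Σ Aⱼᵀ∂ⱼw - B₁ᵀw = 0`, whose supports are controlled by the AFFINE Paley–Wiener deformation
theorem (`Literature.Analysis.Fourier.multiplierOp_expAffine_apply_eq_zero_of_dist`) and the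
complexified symbol bound with zeroth-order term (`exists_hasExpTypeA_adjPencilB`); `∫
  (A₀u)·w dx` is
constant in `t` (`integral_pairFB_eq`, the zeroth-order terms cancelling), so `A₀u(t₀, x₁) = 0` by
localisation with bumps. This is the constant-coefficient case, used for the linearised system (4)
with `B′(ū) ≠ 0`, of "the finite speed of propagation for (1)" [Rauch1986, p. 482], cf.
`Rauch1986_finitePropagationSpeed` and `hasPropagationSpeed_ofConstant` (`B₁ = 0`).
[cite: Rauch1986, Proof of Theorem p. 482; Brenner1973, (0.3) p. 75] -/
theorem hasPropagationSpeed_ofConstant_zeroth (hS : (ofConstant A₀ A B₁).IsRauchClass 0) :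
    ∃ c : ℝ, 0 ≤ c ∧ (ofConstant A₀ A B₁).HasPropagationSpeed 0 c := by
  obtain ⟨hdet, -⟩ := exists_continuous_symmetrizer_family hS
  obtain ⟨c₀, c₁, C, hc₀, hc₁, hC, hT⟩ := exists_hasExpTypeA_adjPencilB hS
  refine ⟨c₀, hc₀, fun T R u hu h0 t ht x hx => ?_⟩
  have h0' : ∀ y : Space d, R < ‖y‖ → u 0 y = 0 := fun y hy => h0 y hy
  rcases ht.1.eq_or_lt with h | htpos
  · subst h
    exact h0' x (by simpa using hx)
  · -- the radius of the test functions
    set r : ℝ := (‖x‖ - R - c₀ * t) / 2 with hr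
    have hr0 : 0 < r := by rw [hr]; linarith
    have hx₁ : 2 * r ≤ ‖x‖ - R - c₀ * t := by rw [hr]; linarith
    -- every entry of `A₀ u(t, x)` vanishes
    have hAu : A₀ *ᵥ u t x = 0 := by
      funext i
      have hcont : Continuous fun y => (A₀ *ᵥ u t y) i :=
        continuous_mulVec_apply (hu.contDiff_slice ht).continuous A₀ i
      refine eq_zero_of_integral_mul_bump_eq_zero hcont x hr0 fun φ hφ => ?_
      -- the test function `φ eᵢ`
      set ψ : Space d → Fin k → ℂ := fun y => ((φ y : ℝ) : ℂ) • (Pi.single i (1 : ℂ)) with hψ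
      have hψd : ContDiff ℝ ∞ ψ :=
        (Complex.ofRealCLM.contDiff.comp φ.contDiff).smul contDiff_const
      have hφc : HasCompactSupport fun y => ((φ y : ℝ) : ℂ) :=
        φ.hasCompactSupport.comp_left Complex.ofReal_zero
      have hψc : HasCompactSupport ψ := hφc.smul_right
      have hψs : tsupport ψ ⊆ closedBall x r := by
        refine (tsupport_smul_subset_left _ _).trans ?_
        refine (closure_mono (Function.support_comp_subset Complex.ofReal_zero _)).trans ?_
        rw [← tsupport, φ.tsupport_eq]
        exact closedBall_subset_closedBall hφ
      have key := integral_mulVec_dotProduct_eq_zero_zeroth hu hdet hC hc₀ hc₁ hT h0' htpos ht.2 hr0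
        hx₁ hψd hψc hψs
      -- evaluate the pairing: `(A₀u)_ℂ · (φ eᵢ) = φ (A₀u)ᵢ`
      have hev : (fun y => (A₀.map (algebraMap ℝ ℂ) *ᵥ cplx (u t) y) ⬝ᵥ ψ y) =
          fun y => (((A₀ *ᵥ u t y) i * φ y : ℝ) : ℂ) := by
        funext y
        rw [cplx_apply, ← ofRealPi_mulVec, hψ]
        simp only [dotProduct_smul, dotProduct_single, mul_one, ofRealPi_apply, smul_eq_mul]
        push_cast
        ring
      rw [hev, integral_complex_ofReal, Complex.ofReal_eq_zero] at key
      exact key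
    have hinj : Function.Injective A₀.mulVec :=
      mulVec_injective_iff_isUnit.2 ((isUnit_iff_isUnit_det _).2 (isUnit_iff_ne_zero.2 hdet))
    exact hinj (by rw [hAu, mulVec_zero])

end Duality


/-! ### The discharge of `Rauch1986_linearL1EstimateForcesCommutation` -/

/-- **Rauch's reduction "(5) makes `M_T(D)` bounded on `Lᵖ`, `1 < p ≤ 2`" for
`M_T = rauchSymbol A₀ A B₁ T` (zeroth-order term included)** — the general-`B₁` form of
`Rauch1986_L1GradientEstimate_imp_LpMultiplier_holds`: the proof of
`isLpMultiplier_rauchSymbol_of_L1GradientEstimate` (`NoBVEstimatesMultiDLinearStepZerothOrder.lean`)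
with its two fact inputs now theorems (`gradientLpBound_interpolation_holds`) resp. replaced by
`hasPropagationSpeed_ofConstant_zeroth`
  (the fact `Rauch1986_finitePropagationSpeed` was applied only
to `ofConstant A₀ A B₁`). [cite: Rauch1986, Proof of Theorem p. 483, (5)–(6)] -/
theorem isLpMultiplier_rauchSymbol_of_L1GradientEstimate' (A₀ : Matrix (Fin k) (Fin k) ℝ)
    (A : Fin d → Matrix (Fin k) (Fin k) ℝ) (B₁ : (Fin k → ℝ) →L[ℝ] (Fin k → ℝ))
    (hS : (ofConstant A₀ A B₁).IsRauchClass 0) {c T : ℝ} (hc : 0 < c) (hT : 0 < T)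
    (hyp : ∀ φ : Space d → Fin k → ℝ, ContDiff ℝ ∞ φ → HasCompactSupport φ →
      ∃ v : ℝ → Space d → Fin k → ℝ,
        (ofConstant A₀ A B₁).IsClassicalSolution T v ∧ (∀ x, v 0 x = φ x) ∧
        HasCompactSupport (v T) ∧
        ∫ x, ‖fderiv ℝ (v T) x‖ ≤ c * ∫ x, ‖fderiv ℝ φ x‖)
    {p : ℝ≥0∞} (hp₁ : 1 < p) (hp₂ : p ≤ 2) : IsLpMultiplier p (rauchSymbol A₀ A B₁ T) := by
  obtain ⟨hdet, -⟩ := exists_continuous_symmetrizer_family hS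
  obtain ⟨cₚ, hcₚ, hps⟩ := hasPropagationSpeed_ofConstant_zeroth hS
  obtain ⟨C₀, hC₀⟩ := exists_nnreal_bound_rauchSymbol hS T
  have hM := measurable_rauchSymbol_apply A₀ A B₁ T
  have hbdd : ∃ C : ℝ, ∀ (ξ : Space d) (a b : Fin k), ‖rauchSymbol A₀ A B₁ T ξ a b‖ ≤ C :=
    ⟨C₀, hC₀⟩
  rcases eq_or_lt_of_le hp₂ with rfl | hp₂'
  · exact isLpMultiplier_two_rauchSymbol hS T
  have h1 := hasGradientLpBoundWith_one_rauchSymbol hS hdet hcₚ hps hT.le hc.le hyp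
  have h2 := hasGradientLpBoundWith_two_of_bounded hM hC₀
  obtain ⟨cp, hcp⟩ :=
    gradientLpBound_interpolation_holds (rauchSymbol A₀ A B₁ T) hM hbdd h1 h2 p hp₁ hp₂'
  exact isLpMultiplier_of_gradientLpBound_holds (rauchSymbol A₀ A B₁ T) hM hbdd p cp hp₁
    (hp₂'.trans ENNReal.ofNat_lt_top) hcp

/-- **Rauch's linear step, discharged**: `Rauch1986_linearL1EstimateForcesCommutation` holds — for a
constant-coefficient system `A₀∂ₜv + Σ Aⱼ∂ⱼv + B₁v = 0` in Rauch's class at `0`, the `L¹` gradient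
estimate (5) at the single time `T` forces `[A₀⁻¹Aⱼ, A₀⁻¹A_l] = 0`. Assembly as in
`Rauch1986_linearL1EstimateForcesCommutation_of_interpolation`: (5) makes `M_T ∈ M_{3/2}`
(`isLpMultiplier_rauchSymbol_of_L1GradientEstimate'`, finite propagation speed for the
constant-coefficient system now being the theorem `hasPropagationSpeed_ofConstant_zeroth`), and
Brenner's criterion with zeroth-order term at the single time
  (`commute_of_isLpMultiplier_rauchSymbol`)
gives (3). [cite: Rauch1986, Theorem p. 482 (linear case) and Proof of Theorem p. 483] -/
theorem Rauch1986_linearL1EstimateForcesCommutation_holds :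
    Rauch1986_linearL1EstimateForcesCommutation := by
  intro d k A₀ A B₁ hS c T hc hT hyp j l
  have hp₁ : (1 : ℝ≥0∞) < (3 / 2 : ℝ≥0) := by
    rw [← ENNReal.coe_one, ENNReal.coe_lt_coe]; norm_num
  have hp₂ : ((3 / 2 : ℝ≥0) : ℝ≥0∞) < 2 := by
    rw [show (2 : ℝ≥0∞) = ((2 : ℝ≥0) : ℝ≥0∞) from rfl, ENNReal.coe_lt_coe]; norm_num
  have hMp : IsLpMultiplier ((3 / 2 : ℝ≥0) : ℝ≥0∞) (rauchSymbol A₀ A B₁ T) :=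
    isLpMultiplier_rauchSymbol_of_L1GradientEstimate' A₀ A B₁ hS hc hT hyp hp₁ hp₂.le
  exact commute_of_isLpMultiplier_rauchSymbol A₀ A B₁ hS hT hp₁.le hp₂.ne hMp j l

/-- **Rauch's theorem `NoBVEstimatesMultiDBarrier` (zeroth-order term `B` with `B(ū) = 0`, `B′(ū)`
arbitrary) relative to its two remaining inputs** — the `L²` small-amplitude expansion
(`Rauch1986_smallAmplitudeExpansionL2`: the `Hˢ` local well-posedness theory of quasilinear
symmetrizable / strictly hyperbolic systems, Rauch's cited Local Existence Theorem) and finite speed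
of propagation for general systems in Rauch's class (`Rauch1986_finitePropagationSpeed`, open only
for strictly hyperbolic quasilinear systems with `d ≥ 2`, `k ≥ 3`) — the whole of Rauch's printed
argument [Rauch1986, Proof of Theorem p. 483] (the expansion's assembly, the linear step with its
single-time appeal to Brenner, both branches, `B′(ū) ≠ 0` included) being proved in the tree.
[cite: Rauch1986, Theorem p. 482 and Proof of Theorem pp. 482–483] -/
theorem NoBVEstimatesMultiDBarrier_of_expansion_propagation
    (hE : Rauch1986_smallAmplitudeExpansionL2) (hF : Rauch1986_finitePropagationSpeed) :
    NoBVEstimatesMultiDBarrier :=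
  NoBVEstimatesMultiDBarrier_of_residualFacts hE hF
    Rauch1986_linearL1EstimateForcesCommutation_holds

end Literature.Barriers.AtomisticToContinuum

end
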